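import Literature.Computability.MetaComplexity.EFChain
import HarnessLib

/-!
# Chains over an operation kit: domain propagation

Layer E/3 of the `EF`-proof construction kit. Along the chain `s_{j+1} = s_j ∘ s_j`,
`t_{j+1} = b_j ? (t_j ∘ s_j) : t_j` of an operation kit, every node stays in the domain `< n`:
`s_j` and `p_j = t_j ∘ s_j` by the domain law of the kit, `t_{j+1}` by a multiplexer argument on
comparators (`muxCmp`: the comparison carries of `cmp(b ? p : q, n)` are the multiplexer of those of
`cmp(p, n)` and `cmp(q, n)`), `t_0 = e` by the global facts. The sound schematic rules of this and
the following chain layers are collected in `Chain.rules`.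

## Sources

* S. A. Cook, R. A. Reckhow, *The relative efficiency of propositional proof systems*,
  J. Symbolic Logic 44 (1979), §2 (sound schematic rules).
* J. Krajíček, *Bounded Arithmetic, Propositional Logic, and Complexity Theory* (CUP 1995), §9.2.
-/

namespace Literature.Computability.MetaComplexity

open _root_.Computability Complexity Complexity.PropForm FregeSystem Netlist

namespace ModAdd

/-! ### The rules of the chain layers -/

namespace Chain

/-- Base of the multiplexer of comparators: three true carry-ins are multiplexer-related.
[cite: CookReckhow1979, §2 (sound rule)] -/
def rMuxCmpBase : FregeRule :=
  ⟨[ctx (var 0) (biimp (var 2) (const true)), ctx (var 0) (biimp (var 3) (const true)), ctx (var 0) (biimp (var 4) (const true))],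
   ctx (var 0) (muxRel 1 2 3 4)⟩

/-- Step of the multiplexer of comparators (metavariables: `g = 1`, carries `2 3 4`, minuend bits
`5 6 7` with `5 ↔ g ? 6 : 7`, the common subtrahend bit `8`, complements `9 10 11`, next carries
`12 13 14`). [cite: CookReckhow1979, §2 (sound rule)] -/
def rMuxCmpStep : FregeRule :=
  ⟨[ctx (var 0) (muxRel 1 2 3 4), ctx (var 0) (muxRel 1 5 6 7),
    ctx (var 0) (biimp (var 9) (neg (var 8))), ctx (var 0) (biimp (var 10) (neg (var 8))), ctx (var 0) (biimp (var 11) (neg (var 8))),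
    ctx (var 0) (biimp (var 12) (majF (var 5) (var 9) (var 2))), ctx (var 0) (biimp (var 13) (majF (var 6) (var 10) (var 3))),
    ctx (var 0) (biimp (var 14) (majF (var 7) (var 11) (var 4)))],
   ctx (var 0) (muxRel 1 12 13 14)⟩

/-- A word is the multiplexer of itself with itself. [cite: CookReckhow1979, §2 (sound rule)] -/
def rMuxSame : FregeRule := ⟨[], ctx (var 0) (muxRel 1 2 2 2)⟩

/-- Functionality of the multiplexer relation. [cite: CookReckhow1979, §2 (sound rule)] -/
def rMuxFun : FregeRule := ⟨[ctx (var 0) (muxRel 1 2 4 5), ctx (var 0) (muxRel 1 3 4 5)], ctx (var 0) (eqv 2 3)⟩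

/-- Congruence of the multiplexer relation in the data inputs. [cite: CookReckhow1979, §2 (sound rule)] -/
def rMuxCongr : FregeRule := ⟨[ctx (var 0) (muxRel 1 2 3 4), ctx (var 0) (eqv 3 5), ctx (var 0) (eqv 4 6)], ctx (var 0) (muxRel 1 2 5 6)⟩

/-- The definition list of the step for `FregeRule.checkD`. [folklore] -/
def dsMuxCmpStep : List (ℕ × PropForm ℕ) :=
  [(2, muxF (var 1) (var 3) (var 4)), (5, muxF (var 1) (var 6) (var 7)), (9, neg (var 8)), (10, neg (var 8)), (11, neg (var 8)),
    (12, majF (var 5) (var 9) (var 2)), (13, majF (var 6) (var 10) (var 3)), (14, majF (var 7) (var 11) (var 4))]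

/-- Soundness check of the step. [cite: CookReckhow1979, §2 (sound rule)] -/
theorem checkD_rMuxCmpStep : rMuxCmpStep.checkD 9 dsMuxCmpStep = true := by decide +kernel

/-- The rules of the chain layers. [cite: CookReckhow1979, §2] -/
def rules : List FregeRule := [rMuxCmpBase, rMuxCmpStep, rMuxSame, rMuxFun, rMuxCongr]

/-- Every rule of the chain layers is sound. [cite: CookReckhow1979, §2 (sound rule)] -/
theorem isSound_of_mem_rules : ∀ r ∈ rules, r.IsSound := by
  intro r hr
  simp only [rules, List.mem_cons, List.not_mem_nil, or_false] at hr
  rcases hr with rfl | rfl | rfl | rfl | rfl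
  · exact FregeRule.isSound_of_check (by decide +kernel)
  · exact FregeRule.isSound_of_checkD checkD_rMuxCmpStep
  · exact FregeRule.isSound_of_check (by decide +kernel)
  · exact FregeRule.isSound_of_check (by decide +kernel)
  · exact FregeRule.isSound_of_check (by decide +kernel)

/-- Membership in `rules`, by position. [folklore] -/
theorem mem_rules (i : ℕ) (hi : i < rules.length) : rules[i] ∈ rules := List.getElem_mem hi

end Chain

/-- `CRulesOK G`: the Frege system contains the rules of the arithmetic kit and of the chain
layers. [folklore] -/
structure CRulesOK (G : FregeSystem) : Prop extends ARulesOK G where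
  /-- the rules of the chain layers -/
  chain : ∀ r ∈ Chain.rules, r ∈ G.rules

/-- All rules so far, as one list. [folklore] -/
def allRulesC : List FregeRule := allRulesA ++ Chain.rules

/-- `allRulesC` contains every layer. [folklore] -/
theorem cRulesOK_allRulesC : CRulesOK ⟨allRulesC⟩ := by
  have h := aRulesOK_allRulesA
  refine ⟨⟨⟨?_, ?_, ?_, ?_, ?_, ?_, ?_, ?_⟩, ?_⟩, ?_⟩ <;> intro r hr <;> simp only [allRulesC, List.mem_append]
  exacts [Or.inl (h.netlist r hr), Or.inl (h.logic r hr), Or.inl (h.adder r hr), Or.inl (h.adderLaw r hr),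
    Or.inl (h.sub r hr), Or.inl (h.order r hr), Or.inl (h.muxNat r hr), Or.inl (h.modAdd r hr), Or.inl (h.assoc r hr), Or.inr hr]

/-- A Frege system containing `allRulesC` satisfies `CRulesOK`. [folklore] -/
theorem cRulesOK_of_subset {G : FregeSystem} (hG : ∀ r ∈ allRulesC, r ∈ G.rules) : CRulesOK G := by
  have h := cRulesOK_allRulesC
  exact ⟨⟨⟨fun r hr => hG r (h.netlist r hr), fun r hr => hG r (h.logic r hr), fun r hr => hG r (h.adder r hr), fun r hr => hG r (h.adderLaw r hr),
    fun r hr => hG r (h.sub r hr), fun r hr => hG r (h.order r hr), fun r hr => hG r (h.muxNat r hr), fun r hr => hG r (h.modAdd r hr)⟩,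
    fun r hr => hG r (h.assoc r hr)⟩, fun r hr => hG r (h.chain r hr)⟩

/-- Every rule of `allRulesC` is sound. [cite: CookReckhow1979, §2 (sound rule)] -/
theorem isSound_allRulesC : ∀ r ∈ allRulesC, r.IsSound := fun r hr => by
  rcases List.mem_append.1 hr with hr | hr
  exacts [isSound_allRulesA r hr, Chain.isSound_of_mem_rules r hr]

namespace Chain

variable {G : FregeSystem} {K : PropForm ℕ} {Γ : Set (PropForm ℕ)}

/-- One inference by the `i`-th chain rule. [cite: CookReckhow1979, §2] -/
theorem infer (hG : CRulesOK G) (i : ℕ) (hi : i < rules.length) {S : Set (PropForm ℕ)} (σ : ℕ → PropForm ℕ) {θ : PropForm ℕ}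
    (hθ : (rules[i]).conclusion.subst σ = θ) (hp : ∀ p ∈ (rules[i]).premises, p.subst σ ∈ S) : G.IsInferredFrom S θ :=
  FregeSystem.IsInferredFrom.of_rule (hG.chain _ (List.getElem_mem hi)) σ hθ hp

/-! ### The multiplexer of comparators -/

/-- **The multiplexer of comparators.** For three available `W`-bit comparators `Ct = cmp(t, n)`,
`Cp = cmp(p, n)`, `Cq = cmp(q, n)` with the same subtrahend and `t = g ? p : q` bitwise, the
comparison carries satisfy `geᵢ(Ct) ↔ (g ? geᵢ(Cp) : geᵢ(Cq))` for all `i ≤ W`.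
[cite: CookReckhow1979, §2] -/
theorem muxCmp (hG : CRulesOK G) (Ct Cp Cq : Sub.View) {W : ℕ} (ht : Ct.Avail K Γ W) (hp : Cp.Avail K Γ W) (hq : Cq.Avail K Γ W)
    (hyp : ∀ i < W, Cp.y i = Ct.y i) (hyq : ∀ i < W, Cq.y i = Ct.y i) {g : ℕ} (hmux : ∀ i < W, ctx K (muxRel g (Ct.x i) (Cp.x i) (Cq.x i)) ∈ Γ) :
    G.Yields Γ (ctxSet K ((List.range (W + 1)).map fun i => muxRel g (Ct.ge W i) (Cp.ge W i) (Cq.ge W i))) ((W + 1) * (K.size + 23 + 1)) := by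
  rw [ctxSet_map_range]
  refine Yields.indexed (line := fun i => ctx K (muxRel g (Ct.ge W i) (Cp.ge W i) (Cq.ge W i))) (fun i hi => Or.inr ?_) fun i _ => by simp [ctx, size]
  rcases i with _ | i
  · exact infer hG 0 (by decide) (FregeSystem.sub [K, var g, var (Ct.ge W 0), var (Cp.ge W 0), var (Cq.ge W 0)]) rfl
      (FregeSystem.prems_cons (Or.inl ht.2.1) (FregeSystem.prems_cons (Or.inl hp.2.1) (FregeSystem.prems_cons (Or.inl hq.2.1) FregeSystem.prems_nil)))
  · have hi' : i < W := by omega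
    have np := hp.1 i hi'; rw [Sub.View.notDef, hyp i hi'] at np
    have nq := hq.1 i hi'; rw [Sub.View.notDef, hyq i hi'] at nq
    exact infer hG 1 (by decide)
      (FregeSystem.sub [K, var g, var (Ct.ge W i), var (Cp.ge W i), var (Cq.ge W i), var (Ct.x i), var (Cp.x i), var (Cq.x i), var (Ct.y i),
        var (Ct.ny i), var (Cp.ny i), var (Cq.ny i), var (Ct.ge W (i + 1)), var (Cp.ge W (i + 1)), var (Cq.ge W (i + 1))]) rfl
      (FregeSystem.prems_cons (Or.inr ⟨i, Nat.lt_succ_self i, rfl⟩) (FregeSystem.prems_cons (Or.inl (hmux i hi'))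
        (FregeSystem.prems_cons (Or.inl (ht.1 i hi')) (FregeSystem.prems_cons (Or.inl np) (FregeSystem.prems_cons (Or.inl nq)
        (FregeSystem.prems_cons (Or.inl (ht.2.2 i hi').2) (FregeSystem.prems_cons (Or.inl (hp.2.2 i hi').2)
        (FregeSystem.prems_cons (Or.inl (hq.2.2 i hi').2) FregeSystem.prems_nil))))))))

/-- **The domain of a multiplexer**: `p, q < n` give `(g ? p : q) < n`. [cite: CookReckhow1979, §2] -/
theorem domMux (hG : CRulesOK G) (Ct Cp Cq : Sub.View) {W : ℕ} (ht : Ct.Avail K Γ W) (hp : Cp.Avail K Γ W) (hq : Cq.Avail K Γ W)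
    (hyp : ∀ i < W, Cp.y i = Ct.y i) (hyq : ∀ i < W, Cq.y i = Ct.y i) {g : ℕ} (hmux : ∀ i < W, ctx K (muxRel g (Ct.x i) (Cp.x i) (Cq.x i)) ∈ Γ)
    (hnp : ctx K (neg (var (Cp.ge W W))) ∈ Γ) (hnq : ctx K (neg (var (Cq.ge W W))) ∈ Γ) :
    G.Yields Γ {ctx K (neg (var (Ct.ge W W)))} ((W + 2) * (K.size + 24)) := by
  have h1 := muxCmp hG Ct Cp Cq ht hp hq hyp hyq hmux
  have h2 : G.Yields (Γ ∪ ctxSet K ((List.range (W + 1)).map fun i => muxRel g (Ct.ge W i) (Cp.ge W i) (Cq.ge W i))) {ctx K (neg (var (Ct.ge W W)))}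
      (K.size + 3) :=
    Yields.muxRel_ff hG.muxNat (Or.inr (mem_ctxSet (List.mem_map.2 ⟨W, List.mem_range.2 (Nat.lt_succ_self W), rfl⟩))) (Or.inl hnp) (Or.inl hnq)
  exact ((h1.trans h2).mono_right Set.subset_union_right).mono_size (by nlinarith [Nat.zero_le W, Nat.zero_le K.size])

/-- A word is the multiplexer of itself (one inference per bit). [cite: CookReckhow1979, §2] -/
theorem muxSame (hG : CRulesOK G) (g : ℕ) (w : ℕ → ℕ) (W : ℕ) : G.Yields Γ (ctxSet K (muxRelW g w w w W)) (W * (K.size + 23 + 1)) :=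
  Yields.ctx_range (fun i _ => Or.inr (infer hG 2 (by decide) (FregeSystem.sub [K, var g, var (w i)]) rfl FregeSystem.prems_nil)) fun _ _ => by simp

/-- **Functionality of the multiplexer relation**, wordwise: two words both equal to `g ? w₁ : w₂`
are equal. [cite: CookReckhow1979, §2] -/
theorem muxFunW (hG : CRulesOK G) {g : ℕ} {w w' w₁ w₂ : ℕ → ℕ} {W : ℕ} (h : Holds K Γ (muxRelW g w w₁ w₂ W)) (h' : Holds K Γ (muxRelW g w' w₁ w₂ W)) :
    G.Yields Γ (ctxSet K (eqW w w' W)) (W * (K.size + 9 + 1)) :=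
  Yields.ctx_range (fun i hi => Or.inr (infer hG 3 (by decide) (FregeSystem.sub [K, var g, var (w i), var (w' i), var (w₁ i), var (w₂ i)]) rfl
    (FregeSystem.prems_cons (holds_muxRelW_iff.1 h i hi) (FregeSystem.prems_cons (holds_muxRelW_iff.1 h' i hi) FregeSystem.prems_nil))))
    fun _ _ => (size_eqv _ _).le

/-- **Congruence of the multiplexer relation in the data words.** [cite: CookReckhow1979, §2] -/
theorem muxCongrW (hG : CRulesOK G) {g : ℕ} {w w₁ w₂ w₁' w₂' : ℕ → ℕ} {W : ℕ} (h : Holds K Γ (muxRelW g w w₁ w₂ W))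
    (h₁ : Holds K Γ (eqW w₁ w₁' W)) (h₂ : Holds K Γ (eqW w₂ w₂' W)) : G.Yields Γ (ctxSet K (muxRelW g w w₁' w₂' W)) (W * (K.size + 23 + 1)) :=
  Yields.ctx_range (fun i hi => Or.inr (infer hG 4 (by decide) (FregeSystem.sub [K, var g, var (w i), var (w₁ i), var (w₂ i), var (w₁' i), var (w₂' i)]) rfl
    (FregeSystem.prems_cons (holds_muxRelW_iff.1 h i hi) (FregeSystem.prems_cons (holds_eqW_iff.1 h₁ i hi)
      (FregeSystem.prems_cons (holds_eqW_iff.1 h₂ i hi) FregeSystem.prems_nil))))) fun _ _ => by simp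

/-- **Literals from constant definitions**, wordwise. [cite: CookReckhow1979, §2] -/
theorem lits_of_cstDefs (hG : CRulesOK G) {w : ℕ → ℕ} {e : ℕ → Bool} {W : ℕ} (h : ∀ i < W, ctx K (biimp (var (w i)) (const (e i))) ∈ Γ) :
    G.Yields Γ (ctxSet K (litW w e W)) (W * (K.size + 2 + 1)) := by
  refine Yields.ctx_range (fun i hi => Or.inr ?_) fun i _ => by cases e i <;> simp [lit, size]
  cases he : e i
  · have h' := h i hi; rw [he] at h'
    exact Logic.infer hG.logic 11 (by decide) (FregeSystem.sub [K, var (w i)]) rfl (FregeSystem.prems_cons h' FregeSystem.prems_nil)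
  · have h' := h i hi; rw [he] at h'
    exact Logic.infer hG.logic 12 (by decide) (FregeSystem.sub [K, var (w i)]) rfl (FregeSystem.prems_cons h' FregeSystem.prems_nil)

end Chain

/-! ### Domain propagation along a chain -/

namespace OpKit

variable {W : ℕ} {k : OpKit W} {o : Occ} {G : FregeSystem} {K : PropForm ℕ} {Γ : Set (PropForm ℕ)}

/-- Inputs of `S_j`: first operand. [folklore] -/
theorem So_x {j i : ℕ} (hi : i < W) : (k.So o j).inp i = k.s o j i := by simp [So, hi]
/-- Inputs of `S_j`: second operand. [folklore] -/
theorem So_y {j i : ℕ} (hi : i < W) : (k.So o j).inp (W + i) = k.s o j i := by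
  simp only [So]; rw [if_neg (by omega), if_pos (by omega), Nat.add_sub_cancel_left]
/-- Inputs of `S_j`: modulus. [folklore] -/
theorem So_n (j i : ℕ) : (k.So o j).inp (2 * W + i) = o.inp (2 * W + i) := by
  simp only [So]; rw [if_neg (by omega), if_neg (by omega)]
/-- Inputs of `P_j`: first operand. [folklore] -/
theorem Po_x {j i : ℕ} (hi : i < W) : (k.Po o j).inp i = k.t o j i := by simp [Po, hi]
/-- Inputs of `P_j`: second operand. [folklore] -/
theorem Po_y {j i : ℕ} (hi : i < W) : (k.Po o j).inp (W + i) = k.s o j i := by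
  simp only [Po]; rw [if_neg (by omega), if_pos (by omega), Nat.add_sub_cancel_left]
/-- Inputs of `P_j`: modulus. [folklore] -/
theorem Po_n (j i : ℕ) : (k.Po o j).inp (2 * W + i) = o.inp (2 * W + i) := by
  simp only [Po]; rw [if_neg (by omega), if_neg (by omega)]

/-- The result of `S_j` is `s_{j+1}`. [folklore] -/
theorem res_So (j : ℕ) : k.res (k.So o j) = k.s o (j + 1) := rfl

variable (k o) in
/-- `DomSupport k o D K Γ`: the auxiliary occurrences of the domain law for every `S_j`, `P_j` and
comparators `D j` of `t_j` with `n` (`j ≤ W`) are available. [folklore] -/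
structure DomSupport (D : ℕ → Sub.View) (K : PropForm ℕ) (Γ : Set (PropForm ℕ)) : Prop where
  /-- domain auxiliaries of `S_j` -/
  dS : ∀ j < W, ∃ a : Occ, a.Avail k.domA.T k.domA.nIn K Γ ∧ AuxWired k.domA.nIn k.domA.src (fun _ => k.So o j) a
  /-- domain auxiliaries of `P_j` -/
  dP : ∀ j < W, ∃ a : Occ, a.Avail k.domA.T k.domA.nIn K Γ ∧ AuxWired k.domA.nIn k.domA.src (fun _ => k.Po o j) a
  /-- the comparators of `t_j` with `n` -/
  hD : ∀ j ≤ W, (D j).Avail K Γ W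
  /-- their first operand -/
  hDx : ∀ j ≤ W, ∀ i < W, (D j).x i = k.t o j i
  /-- their second operand -/
  hDy : ∀ j ≤ W, ∀ i < W, (D j).y i = on W o i

/-- Domain support is monotone. [folklore] -/
theorem DomSupport.mono {D : ℕ → Sub.View} {Γ' : Set (PropForm ℕ)} (h : k.DomSupport o D K Γ) (hΓ : Γ ⊆ Γ') : k.DomSupport o D K Γ' :=
  ⟨fun j hj => (h.dS j hj).imp fun _ ha => ⟨ha.1.mono hΓ, ha.2⟩, fun j hj => (h.dP j hj).imp fun _ ha => ⟨ha.1.mono hΓ, ha.2⟩,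
    fun j hj => (h.hD j hj).mono hΓ, h.hDx, h.hDy⟩

variable (k) in
/-- The size of one step of domain propagation. [folklore] -/
def domStep (W ks : ℕ) : ℕ := 2 * (k.domC.1 * (ks + k.domC.2)) + (6 * W + 4) * (ks + 24)

/-- **Domain propagation along a chain.** For an occurrence with the chain views, domain support,
the certificate `a < n` and the global facts: for every `j ≤ W`, all of `s_{j'} < n` (`j' ≤ j`),
`t_{j'} < n` (as the literal of `D j'`, `j' ≤ j`) and `p_{j'} < n` (`j' < j`, as the literal of the
internal comparator of `P_{j'}`) are derived, in size `(j+1) · domStep`.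
[cite: CookReckhow1979, §2] [cite: Krajicek1995, §9.2] -/
theorem domAll (hG : CRulesOK G) (hk : k.Rules G) (cv : k.ChainViews o K Γ) {D : ℕ → Sub.View} (ds : k.DomSupport o D K Γ)
    (ha : LtN W K Γ (ox o) (on W o)) (hg : GlobW W k.m K Γ (on W o)) :
    ∀ j ≤ W, ∃ Δ : Set (PropForm ℕ), G.Yields Γ Δ ((j + 1) * k.domStep W K.size) ∧
      (∀ j' ≤ j, LtN W K (Γ ∪ Δ) (k.s o j') (on W o)) ∧ (∀ j' ≤ j, ctx K (neg (var ((D j').ge W W))) ∈ Γ ∪ Δ) ∧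
      (∀ j' < j, ctx K (neg (var ((k.cmpV (k.Po o j')).ge W W))) ∈ Γ ∪ Δ)
  | 0, _ => by
    -- `t_0 = e < n` from the global unit word
    obtain ⟨ew, hew, hewlt⟩ := k.e_glob hg
    have b1 := (Chain.lits_of_cstDefs hG (w := k.t o 0) cv.cst).union (Yields.eqW_refl hG.adder K (on W o) W (Γ := Γ))
    set A1 := ctxSet K (litW (k.t o 0) k.e W) ∪ ctxSet K (eqW (on W o) (on W o) W) with hA1
    have b2 : G.Yields (Γ ∪ A1) (ctxSet K (eqW ew (k.t o 0) W)) (W * (K.size + 10)) :=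
      Yields.eqW_of_litW hG.logic (hew.mono Set.subset_union_left) (holds_ctxSet fun θ hθ => Or.inr (Or.inl hθ))
    set A2 := A1 ∪ ctxSet K (eqW ew (k.t o 0) W) with hA2
    have b3 : G.Yields (Γ ∪ A2) {ctx K (neg (var ((D 0).ge W W)))} ((3 * W + 2) * (K.size + 10)) := by
      refine (hewlt.mono Set.subset_union_left).transport hG.toRulesOK (D 0) ((ds.hD 0 (Nat.zero_le W)).mono Set.subset_union_left) le_rfl
        (fun i hi => ?_) fun i hi => ?_
      · rw [ds.hDx 0 (Nat.zero_le W) i hi]; exact Or.inr (Or.inr (mem_ctxSet (mem_eqW hi)))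
      · rw [ds.hDy 0 (Nat.zero_le W) i hi]; exact Or.inr (Or.inl (Or.inr (mem_ctxSet (mem_eqW hi))))
    refine ⟨_, ((b1.trans b2).trans b3).mono_size ?_, fun j' hj' => ?_, fun j' hj' => ?_, fun j' hj' => absurd hj' (Nat.not_lt_zero _)⟩
    · unfold domStep; nlinarith [Nat.zero_le W, Nat.zero_le K.size, Nat.zero_le (k.domC.1 * (K.size + k.domC.2))]
    · rw [Nat.le_zero.1 hj']; exact (ha.mono Set.subset_union_left).congr (fun _ _ => rfl) fun _ _ => rfl
    · rw [Nat.le_zero.1 hj']; exact Or.inr (Or.inr rfl)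
  | j + 1, hj => by
    obtain ⟨Δ, hY, hs, hD, hP⟩ := domAll hG hk cv ds ha hg j (by omega)
    have hjW : j < W := by omega
    have hΓ : ∀ {X : Set (PropForm ℕ)}, Γ ∪ Δ ⊆ Γ ∪ Δ ∪ X := fun {X} => Set.subset_union_left
    -- (1) `s_{j+1} = s_j ∘ s_j < n`
    obtain ⟨aS, haS, hwS⟩ := ds.dS j hjW
    have hsj : LtN W K (Γ ∪ Δ) (ox (k.So o j)) (on W (k.So o j)) := (hs j le_rfl).congr (fun i hi => So_x hi) fun i _ => So_n j i
    have hsj' : LtN W K (Γ ∪ Δ) (oy W (k.So o j)) (on W (k.So o j)) := (hs j le_rfl).congr (fun i hi => So_y hi) fun i _ => So_n j i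
    have hgS : GlobW W k.m K (Γ ∪ Δ) (on W (k.So o j)) := (hg.mono Set.subset_union_left).congr fun i _ => So_n j i
    have c1 := k.dom hk ((cv.S j hjW).mono Set.subset_union_left) (haS.mono Set.subset_union_left) hwS hsj hsj' hgS
    set B1 : Set (PropForm ℕ) := {ctx K (neg (var ((k.cmpV (k.So o j)).ge W W)))} with hB1
    -- (2) `p_j = t_j ∘ s_j < n`
    obtain ⟨aP, haP, hwP⟩ := ds.dP j hjW
    have htj : LtN W K (Γ ∪ Δ) (k.t o j) (on W o) :=
      ⟨(D j).base, (((ds.hD j hjW.le).mono Set.subset_union_left).congr rfl (fun i hi => (ds.hDx j hjW.le i hi).symm)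
        fun i hi => (ds.hDy j hjW.le i hi).symm), hD j le_rfl⟩
    have htj₁ : LtN W K (Γ ∪ Δ ∪ B1) (ox (k.Po o j)) (on W (k.Po o j)) := (htj.mono hΓ).congr (fun i hi => Po_x hi) fun i _ => Po_n j i
    have hsj₁ : LtN W K (Γ ∪ Δ ∪ B1) (oy W (k.Po o j)) (on W (k.Po o j)) := ((hs j le_rfl).mono hΓ).congr (fun i hi => Po_y hi) fun i _ => Po_n j i
    have hgP : GlobW W k.m K (Γ ∪ Δ ∪ B1) (on W (k.Po o j)) := ((hg.mono Set.subset_union_left).mono hΓ).congr fun i _ => Po_n j i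
    have c2 := k.dom hk (((cv.P j hjW).mono Set.subset_union_left).mono hΓ) ((haP.mono Set.subset_union_left).mono hΓ) hwP htj₁ hsj₁ hgP
    set B2 := B1 ∪ {ctx K (neg (var ((k.cmpV (k.Po o j)).ge W W)))} with hB2
    -- (3) `t_{j+1} = (b_j ? p_j : t_j) < n`
    have c3 : G.Yields (Γ ∪ Δ ∪ B2) {ctx K (neg (var ((D (j + 1)).ge W W)))} ((W + 2) * (K.size + 24)) := by
      refine Chain.domMux hG (D (j + 1)) (k.cmpV (k.Po o j)) (D j) (((ds.hD (j + 1) hj).mono Set.subset_union_left).mono hΓ)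
        ((k.cmp_avail (k.Po o j) (((cv.P j hjW).mono Set.subset_union_left).mono hΓ))) (((ds.hD j hjW.le).mono Set.subset_union_left).mono hΓ)
        (fun i hi => ?_) (fun i hi => ?_) (g := o.inp (W + j)) (fun i hi => ?_) (Or.inr (Or.inr rfl)) (Or.inl (hD j le_rfl))
      · show on W (k.Po o j) i = (D (j + 1)).y i; rw [ds.hDy (j + 1) hj i hi]; exact Po_n j i
      · rw [ds.hDy j hjW.le i hi, ds.hDy (j + 1) hj i hi]
      · rw [ds.hDx (j + 1) hj i hi, ds.hDx j hjW.le i hi]; exact Or.inl (Or.inl (cv.mux j hjW i hi))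
    have h := (c1.trans c2).trans c3
    refine ⟨Δ ∪ (B2 ∪ {ctx K (neg (var ((D (j + 1)).ge W W)))}), ?_, fun j' hj' => ?_, fun j' hj' => ?_, fun j' hj' => ?_⟩
    · refine (hY.trans h).mono_size ?_
      unfold domStep; nlinarith [Nat.zero_le W, Nat.zero_le K.size, Nat.zero_le (k.domC.1 * (K.size + k.domC.2)), Nat.zero_le j]
    · have hsub : Γ ∪ Δ ⊆ Γ ∪ (Δ ∪ (B2 ∪ {ctx K (neg (var ((D (j + 1)).ge W W)))})) := by rw [← Set.union_assoc]; exact Set.subset_union_left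
      rcases Nat.lt_succ_iff_lt_or_eq.1 (Nat.lt_succ_iff.2 hj') with hj'' | hj''
      · exact (hs j' (Nat.lt_succ_iff.1 hj'')).mono hsub
      · rw [hj'']
        exact ⟨(k.So o j).base + k.cmpOff, (((k.cmp_avail (k.So o j) (cv.S j hjW)).mono (Set.subset_union_left.trans hsub)).congr rfl
          (fun _ _ => rfl) fun i _ => (So_n j i).symm), Or.inr (Or.inr (Or.inl (Or.inl rfl)))⟩
    · rcases Nat.lt_succ_iff_lt_or_eq.1 (Nat.lt_succ_iff.2 hj') with hj'' | hj''
      · exact (hD j' (Nat.lt_succ_iff.1 hj'')).elim Or.inl fun h => Or.inr (Or.inl h)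
      · rw [hj'']; exact Or.inr (Or.inr (Or.inr rfl))
    · rcases Nat.lt_succ_iff_lt_or_eq.1 hj' with hj'' | hj''
      · exact (hP j' hj'').elim Or.inl fun h => Or.inr (Or.inl h)
      · rw [hj'']; exact Or.inr (Or.inr (Or.inl (Or.inr rfl)))

/-- **The result of a chain is in the domain**: from the literal of `D W`, the final comparator of
the chain answers `<` (congruence of comparators). [cite: CookReckhow1979, §2] -/
theorem domRes (hG : CRulesOK G) (cv : k.ChainViews o K Γ) {D : ℕ → Sub.View} (ds : k.DomSupport o D K Γ)
    (hDW : ctx K (neg (var ((D W).ge W W))) ∈ Γ) : G.Yields Γ {ctx K (neg (var ((k.cmpC o).ge W W)))} ((5 * W + 3) * (K.size + 10)) := by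
  have r1 := (Yields.eqW_refl hG.adder K (k.t o W) W (Γ := Γ)).union (Yields.eqW_refl hG.adder K (on W o) W)
  set A1 := ctxSet K (eqW (k.t o W) (k.t o W) W) ∪ ctxSet K (eqW (on W o) (on W o) W) with hA1
  have r2 : G.Yields (Γ ∪ A1) {χ | χ ∈ Sub.leibLines (k.cmpC o) (D W) K W} ((3 * W + 1) * (K.size + 10)) := by
    refine Yields.of_isBlock (Sub.isBlock_leibLines hG.netlist hG.logic (k.cmpC o) (D W) (cv.cmp.mono Set.subset_union_left)
      ((ds.hD W le_rfl).mono Set.subset_union_left) (fun i hi => ?_) fun i hi => ?_) subset_rfl (Sub.proofSize_leibLines _ _ _ _)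
    · show ctx K (eqv (k.t o W i) ((D W).x i)) ∈ Γ ∪ A1; rw [ds.hDx W le_rfl i hi]; exact Or.inr (Or.inl (mem_ctxSet (mem_eqW hi)))
    · show ctx K (eqv (on W o i) ((D W).y i)) ∈ Γ ∪ A1; rw [ds.hDy W le_rfl i hi]; exact Or.inr (Or.inr (mem_ctxSet (mem_eqW hi)))
  set A2 := A1 ∪ {χ | χ ∈ Sub.leibLines (k.cmpC o) (D W) K W} with hA2
  have r3 : G.Yields (Γ ∪ A2) {ctx K (neg (var ((k.cmpC o).ge W W)))} (2 * (K.size + 10)) :=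
    DomAux.negTransport hG.toRulesOK (Or.inl hDW) (Or.inr (Or.inr (AssocQuot.ge_mem_leibLines _ _ _ _)))
  exact (((r1.trans r2).trans r3).mono_right Set.subset_union_right).mono_size (by nlinarith [Nat.zero_le W, Nat.zero_le K.size])

/-- **The domain law of the chain** (kit form): `a < n` gives `t_W < n` at the final comparator,
given chain views and domain support. [cite: CookReckhow1979, §2] [cite: Krajicek1995, §9.2] -/
theorem domChain (hG : CRulesOK G) (hk : k.Rules G) (cv : k.ChainViews o K Γ) {D : ℕ → Sub.View} (ds : k.DomSupport o D K Γ)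
    (ha : LtN W K Γ (ox o) (on W o)) (hg : GlobW W k.m K Γ (on W o)) :
    G.Yields Γ {ctx K (neg (var ((k.cmpC o).ge W W)))} ((W + 1) * k.domStep W K.size + (5 * W + 3) * (K.size + 10)) := by
  obtain ⟨Δ, hY, -, hD, -⟩ := domAll hG hk cv ds ha hg W le_rfl
  have h := domRes hG (cv.mono Set.subset_union_left) (ds.mono Set.subset_union_left) (hD W le_rfl)
  exact (hY.trans h).mono_right Set.subset_union_right

end OpKit

end ModAdd

end Literature.Computability.MetaComplexity

/-!
# Chains over an operation kit: the chain of the unit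

Layer E/4 of the `EF`-proof construction kit. If the first operand of a chain is the unit word
`e` then every node of the chain is `e`: `s_{j+1} = e ∘ e = e` and `p_j = e ∘ s_j = e` by the left
unit law of the kit, `t_{j+1} = b_j ? p_j : t_j = e` by the multiplexer rules. Over multiplication
this is `1 ^ b = 1`, over modular addition `0 · b = 0`.

## Sources

* S. A. Cook, R. A. Reckhow, *The relative efficiency of propositional proof systems*,
  J. Symbolic Logic 44 (1979), §2.
* J. Krajíček, *Bounded Arithmetic, Propositional Logic, and Complexity Theory* (CUP 1995), §9.2.
-/

namespace Literature.Computability.MetaComplexity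

open _root_.Computability Complexity Complexity.PropForm FregeSystem Netlist

namespace ModAdd

namespace OpKit

variable {W : ℕ} {k : OpKit W} {o : Occ} {G : FregeSystem} {K : PropForm ℕ} {Γ : Set (PropForm ℕ)}

variable (k o) in
/-- `UnitSupport k o K Γ`: the auxiliary occurrences of the left unit law for every `S_j` and `P_j`
are available. [folklore] -/
structure UnitSupport (K : PropForm ℕ) (Γ : Set (PropForm ℕ)) : Prop where
  /-- unit auxiliaries of `S_j` -/
  uS : ∀ j < W, ∃ a : Occ, a.Avail k.unitA.T k.unitA.nIn K Γ ∧ AuxWired k.unitA.nIn k.unitA.src (fun _ => k.So o j) a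
  /-- unit auxiliaries of `P_j` -/
  uP : ∀ j < W, ∃ a : Occ, a.Avail k.unitA.T k.unitA.nIn K Γ ∧ AuxWired k.unitA.nIn k.unitA.src (fun _ => k.Po o j) a

/-- Unit support is monotone. [folklore] -/
theorem UnitSupport.mono {Γ' : Set (PropForm ℕ)} (h : k.UnitSupport o K Γ) (hΓ : Γ ⊆ Γ') : k.UnitSupport o K Γ' :=
  ⟨fun j hj => (h.uS j hj).imp fun _ ha => ⟨ha.1.mono hΓ, ha.2⟩, fun j hj => (h.uP j hj).imp fun _ ha => ⟨ha.1.mono hΓ, ha.2⟩⟩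

/-- Literals of a word transfer along pointwise equal words (below `W`). [folklore] -/
theorem holds_litW_congr {a b : ℕ → ℕ} {bits : ℕ → Bool} (h : Holds K Γ (litW a bits W)) (hab : ∀ i < W, b i = a i) :
    Holds K Γ (litW b bits W) :=
  holds_litW_iff.2 fun i hi => by rw [hab i hi]; exact holds_litW_iff.1 h i hi

/-- **Literals of a multiplexer of two words with the same literals.** [cite: CookReckhow1979, §2] -/
theorem litW_mux (hG : CRulesOK G) {g : ℕ} {w w₁ w₂ : ℕ → ℕ} {bits : ℕ → Bool} (hm : Holds K Γ (muxRelW g w w₁ w₂ W))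
    (h₁ : Holds K Γ (litW w₁ bits W)) (h₂ : Holds K Γ (litW w₂ bits W)) : G.Yields Γ (ctxSet K (litW w bits W)) (W * (K.size + 2 + 1)) := by
  refine Yields.ctx_range (fun i hi => Or.inr ?_) fun i _ => by cases bits i <;> simp [lit, size]
  have hl₁ := holds_litW_iff.1 h₁ i hi
  have hl₂ := holds_litW_iff.1 h₂ i hi
  have hmi := holds_muxRelW_iff.1 hm i hi
  cases hb : bits i <;> rw [hb] at hl₁ hl₂
  · exact FregeSystem.IsInferredFrom.of_rule (hG.muxNat _ mem_muxNatRules.2.1) (FregeSystem.sub [K, var (w i), var g, var (w₁ i), var (w₂ i)]) rfl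
      (FregeSystem.prems_cons hmi (FregeSystem.prems_cons hl₁ (FregeSystem.prems_cons hl₂ FregeSystem.prems_nil)))
  · exact FregeSystem.IsInferredFrom.of_rule (hG.muxNat _ mem_muxNatRules.2.2) (FregeSystem.sub [K, var (w i), var g, var (w₁ i), var (w₂ i)]) rfl
      (FregeSystem.prems_cons hmi (FregeSystem.prems_cons hl₁ (FregeSystem.prems_cons hl₂ FregeSystem.prems_nil)))

variable (k) in
/-- The size of one step of the unit chain. [folklore] -/
def unitStep (W ks : ℕ) : ℕ := 2 * (k.unitC.1 * (ks + k.unitC.2)) + (5 * W) * (ks + 10)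

/-- **The chain of the unit.** If the first operand is the unit word `e` (and the domain facts of
the nodes are available), every `s_j` and `t_j` (`j ≤ W`) carries the literals of `e`.
[cite: CookReckhow1979, §2] [cite: Krajicek1995, §9.2] -/
theorem unitAll (hG : CRulesOK G) (hk : k.Rules G) (cv : k.ChainViews o K Γ) (us : k.UnitSupport o K Γ)
    (hs : ∀ j ≤ W, LtN W K Γ (k.s o j) (on W o)) (hg : GlobW W k.m K Γ (on W o)) (he : Holds K Γ (litW (ox o) k.e W)) :
    ∀ j ≤ W, ∃ Δ : Set (PropForm ℕ), G.Yields Γ Δ ((j + 1) * k.unitStep W K.size) ∧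
      (∀ j' ≤ j, Holds K (Γ ∪ Δ) (litW (k.s o j') k.e W)) ∧ (∀ j' ≤ j, Holds K (Γ ∪ Δ) (litW (k.t o j') k.e W))
  | 0, _ => by
    refine ⟨_, (Chain.lits_of_cstDefs hG (w := k.t o 0) cv.cst).mono_size ?_, fun j' hj' => ?_, fun j' hj' => ?_⟩
    · unfold unitStep; nlinarith [Nat.zero_le W, Nat.zero_le K.size, Nat.zero_le (k.unitC.1 * (K.size + k.unitC.2))]
    · rw [Nat.le_zero.1 hj']; exact he.mono Set.subset_union_left
    · rw [Nat.le_zero.1 hj']; exact holds_ctxSet Set.subset_union_right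
  | j + 1, hj => by
    obtain ⟨Δ, hY, hsl, htl⟩ := unitAll hG hk cv us hs hg he j (by omega)
    have hjW : j < W := by omega
    have hΓ : ∀ {X : Set (PropForm ℕ)}, Γ ∪ Δ ⊆ Γ ∪ Δ ∪ X := fun {X} => Set.subset_union_left
    -- (1) `s_{j+1} = e ∘ s_j = s_j`
    obtain ⟨aS, haS, hwS⟩ := us.uS j hjW
    have c1 := k.unitL hk ((cv.S j hjW).mono Set.subset_union_left) (haS.mono Set.subset_union_left) hwS
      (holds_litW_congr (hsl j le_rfl) fun i hi => So_x hi)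
      (((hs j hjW.le).mono Set.subset_union_left).congr (fun i hi => So_y hi) fun i _ => So_n j i) ((hg.mono Set.subset_union_left).congr fun i _ => So_n j i)
    set B1 := ctxSet K (eqW (k.res (k.So o j)) (oy W (k.So o j)) W) with hB1
    -- (2) `p_j = e ∘ s_j = s_j`
    obtain ⟨aP, haP, hwP⟩ := us.uP j hjW
    have c2 := k.unitL hk (Γ := Γ ∪ Δ ∪ B1) (((cv.P j hjW).mono Set.subset_union_left).mono hΓ) ((haP.mono Set.subset_union_left).mono hΓ) hwP
      (holds_litW_congr ((htl j le_rfl).mono hΓ) fun i hi => Po_x hi)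
      ((((hs j hjW.le).mono Set.subset_union_left).mono hΓ).congr (fun i hi => Po_y hi) fun i _ => Po_n j i)
      (((hg.mono Set.subset_union_left).mono hΓ).congr fun i _ => Po_n j i)
    set B2 := B1 ∪ ctxSet K (eqW (k.res (k.Po o j)) (oy W (k.Po o j)) W) with hB2
    -- (3) the equalities reversed, then the literals of `s_{j+1}` and `p_j`
    have c3 := (Yields.eqW_symm hG.logic (K := K) (Γ := Γ ∪ Δ ∪ B2) (a := k.res (k.So o j)) (b := oy W (k.So o j)) (W := W)
      (holds_ctxSet fun θ hθ => Or.inr (Or.inl hθ))).union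
      (Yields.eqW_symm hG.logic (K := K) (Γ := Γ ∪ Δ ∪ B2) (a := k.res (k.Po o j)) (b := oy W (k.Po o j)) (W := W)
      (holds_ctxSet fun θ hθ => Or.inr (Or.inr hθ)))
    set B3 := B2 ∪ (ctxSet K (eqW (oy W (k.So o j)) (k.res (k.So o j)) W) ∪ ctxSet K (eqW (oy W (k.Po o j)) (k.res (k.Po o j)) W)) with hB3
    have c4 := (Yields.litW_transport hG.logic (K := K) (Γ := Γ ∪ Δ ∪ B3) (a := oy W (k.So o j)) (b := k.res (k.So o j)) (bits := k.e) (W := W)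
      (holds_litW_congr ((hsl j le_rfl).mono hΓ) fun i hi => So_y hi) (holds_ctxSet fun θ hθ => Or.inr (Or.inr (Or.inl hθ)))).union
      (Yields.litW_transport hG.logic (K := K) (Γ := Γ ∪ Δ ∪ B3) (a := oy W (k.Po o j)) (b := k.res (k.Po o j)) (bits := k.e) (W := W)
      (holds_litW_congr ((hsl j le_rfl).mono hΓ) fun i hi => Po_y hi) (holds_ctxSet fun θ hθ => Or.inr (Or.inr (Or.inr hθ))))
    set B4 := B3 ∪ (ctxSet K (litW (k.res (k.So o j)) k.e W) ∪ ctxSet K (litW (k.res (k.Po o j)) k.e W)) with hB4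
    -- (4) `t_{j+1} = b_j ? p_j : t_j`
    have c5 : G.Yields (Γ ∪ Δ ∪ B4) (ctxSet K (litW (k.t o (j + 1)) k.e W)) (W * (K.size + 2 + 1)) :=
      litW_mux hG (holds_muxRelW_iff.2 fun i hi => Or.inl (Or.inl (cv.mux j hjW i hi))) (holds_ctxSet fun θ hθ => Or.inr (Or.inr (Or.inr hθ)))
        ((htl j le_rfl).mono hΓ)
    have h := (((c1.trans c2).trans c3).trans c4).trans c5
    refine ⟨Δ ∪ (B4 ∪ ctxSet K (litW (k.t o (j + 1)) k.e W)), (hY.trans h).mono_size ?_, fun j' hj' => ?_, fun j' hj' => ?_⟩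
    · unfold unitStep; nlinarith [Nat.zero_le W, Nat.zero_le K.size, Nat.zero_le (k.unitC.1 * (K.size + k.unitC.2)), Nat.zero_le j]
    · have hsub : Γ ∪ Δ ⊆ Γ ∪ (Δ ∪ (B4 ∪ ctxSet K (litW (k.t o (j + 1)) k.e W))) := by rw [← Set.union_assoc]; exact Set.subset_union_left
      rcases Nat.lt_succ_iff_lt_or_eq.1 (Nat.lt_succ_iff.2 hj') with hj'' | hj''
      · exact (hsl j' (Nat.lt_succ_iff.1 hj'')).mono hsub
      · rw [hj'']; exact holds_ctxSet fun θ hθ => Or.inr (Or.inr (Or.inl (Or.inr (Or.inl hθ))))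
    · have hsub : Γ ∪ Δ ⊆ Γ ∪ (Δ ∪ (B4 ∪ ctxSet K (litW (k.t o (j + 1)) k.e W))) := by rw [← Set.union_assoc]; exact Set.subset_union_left
      rcases Nat.lt_succ_iff_lt_or_eq.1 (Nat.lt_succ_iff.2 hj') with hj'' | hj''
      · exact (htl j' (Nat.lt_succ_iff.1 hj'')).mono hsub
      · rw [hj'']; exact holds_ctxSet fun θ hθ => Or.inr (Or.inr (Or.inr hθ))

/-- **The chain of the unit, with domain propagation**: from the chain views, domain and unit
support, `a < n` with `a = e`, and the global facts, the result `t_W` carries the literals of `e`.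
[cite: CookReckhow1979, §2] [cite: Krajicek1995, §9.2] -/
theorem unitChain (hG : CRulesOK G) (hk : k.Rules G) (cv : k.ChainViews o K Γ) {D : ℕ → Sub.View} (ds : k.DomSupport o D K Γ)
    (us : k.UnitSupport o K Γ) (ha : LtN W K Γ (ox o) (on W o)) (hg : GlobW W k.m K Γ (on W o)) (he : Holds K Γ (litW (ox o) k.e W)) :
    ∃ Δ : Set (PropForm ℕ), G.Yields Γ Δ ((W + 1) * k.domStep W K.size + (W + 1) * k.unitStep W K.size) ∧
      (∀ j ≤ W, Holds K (Γ ∪ Δ) (litW (k.s o j) k.e W)) ∧ (∀ j ≤ W, Holds K (Γ ∪ Δ) (litW (k.t o j) k.e W)) ∧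
      (∀ j ≤ W, LtN W K (Γ ∪ Δ) (k.s o j) (on W o)) ∧ (∀ j ≤ W, ctx K (neg (var ((D j).ge W W))) ∈ Γ ∪ Δ) := by
  obtain ⟨Δ₁, hY₁, hs, hD, -⟩ := domAll hG hk cv ds ha hg W le_rfl
  obtain ⟨Δ₂, hY₂, hsl, htl⟩ := unitAll hG hk (cv.mono Set.subset_union_left) (us.mono Set.subset_union_left) hs (hg.mono Set.subset_union_left)
    (he.mono Set.subset_union_left) W le_rfl
  refine ⟨Δ₁ ∪ Δ₂, hY₁.trans hY₂, fun j hj => ?_, fun j hj => ?_, fun j hj => ?_, fun j hj => ?_⟩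
  · rw [← Set.union_assoc]; exact hsl j hj
  · rw [← Set.union_assoc]; exact htl j hj
  · rw [← Set.union_assoc]; exact (hs j hj).mono Set.subset_union_left
  · rw [← Set.union_assoc]; exact Or.inl (hD j hj)

end OpKit

end ModAdd

end Literature.Computability.MetaComplexity

/-!
# Chains over an operation kit: distributivity of the chain over the operation

Layer E/5 of the `EF`-proof construction kit. For an operation kit with the medial law, the chain
is a homomorphism in its first argument:

  `CH(a ∘ a', b) = CH(a, b) ∘ CH(a', b)`

(over modular addition: `(a + a') · b = a·b + a'·b`; over multiplication: `(a·a')^b = a^b · a'^b`).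
Inside Frege (`OpKit.dist`): along `j`, the nodes of the chain `A = CH(a ∘ a', b)` are provably the
operation applied to the corresponding nodes of `B = CH(a, b)` and `C = CH(a', b)`:
`s^A_j = s^B_j ∘ s^C_j` (occurrences `Q_j`) and `t^A_j = t^B_j ∘ t^C_j` (occurrences `R_j`), by
congruence, the medial law (twice per step, on the occurrences `QQ_j`, `PP_j`, `PR_j`) and
multiplexer naturality.

## Sources

* S. A. Cook, R. A. Reckhow, *The relative efficiency of propositional proof systems*,
  J. Symbolic Logic 44 (1979), §2.
* J. Krajíček, *Bounded Arithmetic, Propositional Logic, and Complexity Theory* (CUP 1995), §9.2.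
-/

namespace Literature.Computability.MetaComplexity

open _root_.Computability Complexity Complexity.PropForm FregeSystem Netlist

namespace ModAdd

namespace OpKit

variable {W : ℕ} (k : OpKit W)

/-- The occurrences of the first medial instance of step `j`:
`(s^B ∘ s^C) ∘ (s^B ∘ s^C) = (s^B ∘ s^B) ∘ (s^C ∘ s^C)`. [folklore] -/
def os1 (B C : Occ) (Q QQ : ℕ → Occ) (j r : ℕ) : Occ :=
  if r = 0 then Q j else if r = 1 then Q j else if r = 2 then QQ j else if r = 3 then k.So B j else if r = 4 then k.So C j else Q (j + 1)

/-- The occurrences of the second medial instance of step `j`: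
`(t^B ∘ t^C) ∘ (s^B ∘ s^C) = (t^B ∘ s^B) ∘ (t^C ∘ s^C)`. [folklore] -/
def os2 (B C : Occ) (Q R PP PR : ℕ → Occ) (j r : ℕ) : Occ :=
  if r = 0 then R j else if r = 1 then Q j else if r = 2 then PP j else if r = 3 then k.Po B j else if r = 4 then k.Po C j else PR j

/-- `DistShape`: the wiring of the occurrences of the distributivity law. `O = a ∘ a'`;
`A = CH(res O, b)`, `B = CH(a, b)`, `C = CH(a', b)`; `Q_j = s^B_j ∘ s^C_j`, `R_j = t^B_j ∘ t^C_j`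
(`j ≤ W`); `QQ_j = Q_j ∘ Q_j`, `PP_j = R_j ∘ Q_j`, `PR_j = p^B_j ∘ p^C_j` (`j < W`); all with the `n`
of `O`. [folklore] -/
structure DistShape (O A B C : Occ) (Q R QQ PP PR : ℕ → Occ) : Prop where
  /-- `A` reads `res O` -/
  hAa : ∀ i < W, A.inp i = k.res O i
  /-- `B` reads `a` -/
  hBa : ∀ i < W, B.inp i = O.inp i
  /-- `C` reads `a'` -/
  hCa : ∀ i < W, C.inp i = O.inp (W + i)
  /-- same `b` -/
  hAb : ∀ j < W, A.inp (W + j) = B.inp (W + j)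
  /-- same `b` -/
  hCb : ∀ j < W, C.inp (W + j) = B.inp (W + j)
  /-- same `n` -/
  hAn : ∀ i < W, A.inp (2 * W + i) = O.inp (2 * W + i)
  /-- same `n` -/
  hBn : ∀ i < W, B.inp (2 * W + i) = O.inp (2 * W + i)
  /-- same `n` -/
  hCn : ∀ i < W, C.inp (2 * W + i) = O.inp (2 * W + i)
  /-- `Q_j` -/
  hQx : ∀ j ≤ W, ∀ i < W, (Q j).inp i = k.s B j i
  /-- `Q_j` -/
  hQy : ∀ j ≤ W, ∀ i < W, (Q j).inp (W + i) = k.s C j i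
  /-- `Q_j` -/
  hQn : ∀ j ≤ W, ∀ i < W, (Q j).inp (2 * W + i) = O.inp (2 * W + i)
  /-- `R_j` -/
  hRx : ∀ j ≤ W, ∀ i < W, (R j).inp i = k.t B j i
  /-- `R_j` -/
  hRy : ∀ j ≤ W, ∀ i < W, (R j).inp (W + i) = k.t C j i
  /-- `R_j` -/
  hRn : ∀ j ≤ W, ∀ i < W, (R j).inp (2 * W + i) = O.inp (2 * W + i)
  /-- `QQ_j` -/
  hQQx : ∀ j < W, ∀ i < W, (QQ j).inp i = k.res (Q j) i
  /-- `QQ_j` -/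
  hQQy : ∀ j < W, ∀ i < W, (QQ j).inp (W + i) = k.res (Q j) i
  /-- `QQ_j` -/
  hQQn : ∀ j < W, ∀ i < W, (QQ j).inp (2 * W + i) = O.inp (2 * W + i)
  /-- `PP_j` -/
  hPPx : ∀ j < W, ∀ i < W, (PP j).inp i = k.res (R j) i
  /-- `PP_j` -/
  hPPy : ∀ j < W, ∀ i < W, (PP j).inp (W + i) = k.res (Q j) i
  /-- `PP_j` -/
  hPPn : ∀ j < W, ∀ i < W, (PP j).inp (2 * W + i) = O.inp (2 * W + i)
  /-- `PR_j` -/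
  hPRx : ∀ j < W, ∀ i < W, (PR j).inp i = k.p B j i
  /-- `PR_j` -/
  hPRy : ∀ j < W, ∀ i < W, (PR j).inp (W + i) = k.p C j i
  /-- `PR_j` -/
  hPRn : ∀ j < W, ∀ i < W, (PR j).inp (2 * W + i) = O.inp (2 * W + i)

/-- `DistAvail`: the occurrences of the distributivity law, the medial auxiliaries of both medial
instances of every step and the unit auxiliary of `R_0` are available. [folklore] -/
structure DistAvail (O A B C : Occ) (Q R QQ PP PR : ℕ → Occ) (K : PropForm ℕ) (Γ : Set (PropForm ℕ)) : Prop where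
  /-- `O` -/
  hO : O.Avail k.T (3 * W) K Γ
  /-- `A` -/
  cvA : k.ChainViews A K Γ
  /-- `B` -/
  cvB : k.ChainViews B K Γ
  /-- `C` -/
  cvC : k.ChainViews C K Γ
  /-- `Q_j` -/
  hQ : ∀ j ≤ W, (Q j).Avail k.T (3 * W) K Γ
  /-- `R_j` -/
  hR : ∀ j ≤ W, (R j).Avail k.T (3 * W) K Γ
  /-- `QQ_j` -/
  hQQ : ∀ j < W, (QQ j).Avail k.T (3 * W) K Γ
  /-- `PP_j` -/
  hPP : ∀ j < W, (PP j).Avail k.T (3 * W) K Γ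
  /-- `PR_j` -/
  hPR : ∀ j < W, (PR j).Avail k.T (3 * W) K Γ
  /-- medial auxiliaries, first instance -/
  m1 : ∀ j < W, ∃ a : Occ, a.Avail k.medA.T k.medA.nIn K Γ ∧ AuxWired k.medA.nIn k.medA.src (k.os1 B C Q QQ j) a
  /-- medial auxiliaries, second instance -/
  m2 : ∀ j < W, ∃ a : Occ, a.Avail k.medA.T k.medA.nIn K Γ ∧ AuxWired k.medA.nIn k.medA.src (k.os2 B C Q R PP PR j) a
  /-- unit auxiliary of `R_0` -/
  uR : ∃ a : Occ, a.Avail k.unitA.T k.unitA.nIn K Γ ∧ AuxWired k.unitA.nIn k.unitA.src (fun _ => R 0) a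

variable {k}
variable {O A B C : Occ} {Q R QQ PP PR : ℕ → Occ} {G : FregeSystem} {K : PropForm ℕ} {Γ : Set (PropForm ℕ)}

/-- Availability of the distributivity data is monotone. [folklore] -/
theorem DistAvail.mono {Γ' : Set (PropForm ℕ)} (h : k.DistAvail O A B C Q R QQ PP PR K Γ) (hΓ : Γ ⊆ Γ') : k.DistAvail O A B C Q R QQ PP PR K Γ' :=
  ⟨h.hO.mono hΓ, h.cvA.mono hΓ, h.cvB.mono hΓ, h.cvC.mono hΓ, fun j hj => (h.hQ j hj).mono hΓ, fun j hj => (h.hR j hj).mono hΓ,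
    fun j hj => (h.hQQ j hj).mono hΓ, fun j hj => (h.hPP j hj).mono hΓ, fun j hj => (h.hPR j hj).mono hΓ,
    fun j hj => (h.m1 j hj).imp fun _ ha => ⟨ha.1.mono hΓ, ha.2⟩, fun j hj => (h.m2 j hj).imp fun _ ha => ⟨ha.1.mono hΓ, ha.2⟩,
    h.uR.imp fun _ ha => ⟨ha.1.mono hΓ, ha.2⟩⟩

/-- The first medial instance is in medial shape. [folklore] -/
theorem mShape1 (sh : k.DistShape O A B C Q R QQ PP PR) {j : ℕ} (hj : j < W) : MShape W k.res (k.os1 B C Q QQ j) := by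
  have e0 : k.os1 B C Q QQ j 0 = Q j := rfl
  have e1 : k.os1 B C Q QQ j 1 = Q j := rfl
  have e2 : k.os1 B C Q QQ j 2 = QQ j := rfl
  have e3 : k.os1 B C Q QQ j 3 = k.So B j := rfl
  have e4 : k.os1 B C Q QQ j 4 = k.So C j := rfl
  have e5 : k.os1 B C Q QQ j 5 = Q (j + 1) := rfl
  refine ⟨fun i hi => ?_, fun i hi => ?_, fun i hi => ?_, fun i hi => ?_, fun i hi => ?_, fun i hi => ?_, fun i hi => ?_, fun i hi => ?_, fun r hr hr' i hi => ?_⟩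
  · rw [e2, e0]; exact sh.hQQx j hj i hi
  · rw [e2, e1]; exact sh.hQQy j hj i hi
  · rw [e3, e0, So_x hi, sh.hQx j hj.le i hi]
  · rw [e3, e1, So_y hi, sh.hQx j hj.le i hi]
  · rw [e4, e0, So_x hi, sh.hQy j hj.le i hi]
  · rw [e4, e1, So_y hi, sh.hQy j hj.le i hi]
  · rw [e5, e3, sh.hQx (j + 1) hj i hi]; rfl
  · rw [e5, e4, sh.hQy (j + 1) hj i hi]; rfl
  · rw [e0, sh.hQn j hj.le i hi]
    obtain rfl | rfl | rfl | rfl | rfl : r = 1 ∨ r = 2 ∨ r = 3 ∨ r = 4 ∨ r = 5 := by omega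
    · rw [e1, sh.hQn j hj.le i hi]
    · rw [e2, sh.hQQn j hj i hi]
    · rw [e3, So_n, sh.hBn i hi]
    · rw [e4, So_n, sh.hCn i hi]
    · rw [e5, sh.hQn (j + 1) hj i hi]

/-- The second medial instance is in medial shape. [folklore] -/
theorem mShape2 (sh : k.DistShape O A B C Q R QQ PP PR) {j : ℕ} (hj : j < W) : MShape W k.res (k.os2 B C Q R PP PR j) := by
  have e0 : k.os2 B C Q R PP PR j 0 = R j := rfl
  have e1 : k.os2 B C Q R PP PR j 1 = Q j := rfl
  have e2 : k.os2 B C Q R PP PR j 2 = PP j := rfl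
  have e3 : k.os2 B C Q R PP PR j 3 = k.Po B j := rfl
  have e4 : k.os2 B C Q R PP PR j 4 = k.Po C j := rfl
  have e5 : k.os2 B C Q R PP PR j 5 = PR j := rfl
  refine ⟨fun i hi => ?_, fun i hi => ?_, fun i hi => ?_, fun i hi => ?_, fun i hi => ?_, fun i hi => ?_, fun i hi => ?_, fun i hi => ?_, fun r hr hr' i hi => ?_⟩
  · rw [e2, e0]; exact sh.hPPx j hj i hi
  · rw [e2, e1]; exact sh.hPPy j hj i hi
  · rw [e3, e0, Po_x hi, sh.hRx j hj.le i hi]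
  · rw [e3, e1, Po_y hi, sh.hQx j hj.le i hi]
  · rw [e4, e0, Po_x hi, sh.hRy j hj.le i hi]
  · rw [e4, e1, Po_y hi, sh.hQy j hj.le i hi]
  · rw [e5, e3, sh.hPRx j hj i hi]; rfl
  · rw [e5, e4, sh.hPRy j hj i hi]; rfl
  · rw [e0, sh.hRn j hj.le i hi]
    obtain rfl | rfl | rfl | rfl | rfl : r = 1 ∨ r = 2 ∨ r = 3 ∨ r = 4 ∨ r = 5 := by omega
    · rw [e1, sh.hQn j hj.le i hi]
    · rw [e2, sh.hPPn j hj i hi]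
    · rw [e3, Po_n, sh.hBn i hi]
    · rw [e4, Po_n, sh.hCn i hi]
    · rw [e5, sh.hPRn j hj i hi]

/-- **Congruence of two occurrences of the operation** whose operand words are provably equal and
whose `n` are the same variables: their results are provably equal. [cite: CookReckhow1979, §2] -/
theorem resLeib (hG : CRulesOK G) {o o' : Occ} (ho : o.Avail k.T (3 * W) K Γ) (ho' : o'.Avail k.T (3 * W) K Γ) {x y x' y' nw : ℕ → ℕ}
    (hx : ∀ i < W, o.inp i = x i) (hy : ∀ i < W, o.inp (W + i) = y i) (hn : ∀ i < W, o.inp (2 * W + i) = nw i)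
    (hx' : ∀ i < W, o'.inp i = x' i) (hy' : ∀ i < W, o'.inp (W + i) = y' i) (hn' : ∀ i < W, o'.inp (2 * W + i) = nw i)
    (hex : Holds K Γ (eqW x x' W)) (hey : Holds K Γ (eqW y y' W)) :
    G.Yields Γ (ctxSet K (eqW (k.res o) (k.res o') W)) ((k.T.length + 2 * W) * (K.size + 10)) := by
  have r1 := Yields.eqW_refl hG.adder K nw W (Γ := Γ)
  have r2 : G.Yields (Γ ∪ ctxSet K (eqW nw nw W)) {χ | χ ∈ leibLines (o.inst (3 * W)) (o'.inst (3 * W)) K k.T.length} (k.T.length * (K.size + 10)) := by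
    refine occLeib hG.netlist k.wf o o' (ho.mono Set.subset_union_left) (ho'.mono Set.subset_union_left) fun q hq => ?_
    by_cases h1 : q < W
    · rw [hx q h1, hx' q h1]; exact Or.inl (holds_eqW_iff.1 hex q h1)
    · by_cases h2 : q < 2 * W
      · obtain ⟨i, rfl⟩ : ∃ i, q = W + i := ⟨q - W, by omega⟩
        rw [hy i (by omega), hy' i (by omega)]; exact Or.inl (holds_eqW_iff.1 hey i (by omega))
      · obtain ⟨i, rfl⟩ : ∃ i, q = 2 * W + i := ⟨q - 2 * W, by omega⟩
        rw [hn i (by omega), hn' i (by omega)]; exact Or.inr (mem_ctxSet (mem_eqW (by omega)))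
  refine ((r1.trans r2).mono_right ?_).mono_size (by nlinarith [Nat.zero_le W, Nat.zero_le K.size, Nat.zero_le k.T.length])
  rintro θ ⟨L, hL, rfl⟩
  obtain ⟨i, hi, rfl⟩ := List.mem_map.1 hL
  exact Or.inr (wire_mem_occLeib (k.resOff_lt i (List.mem_range.1 hi)))

variable (k) in
/-- The size of one step of the distributivity law. [folklore] -/
def distStep (W ks : ℕ) : ℕ :=
  2 * (k.medC.1 * (ks + k.medC.2)) + k.unitC.1 * (ks + k.unitC.2) + (3 * k.T.length + 16 * W + 12) * (ks + 24)

/-- **Distributivity of the chain over the operation, along the nodes.** Under the distributivity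
data, the domain facts of the nodes of `B` and `C` and the global facts: for all `j ≤ W`,
`s^A_j = res Q_j` and `t^A_j = res R_j`, derived in size `(j+1) · distStep`.
[cite: CookReckhow1979, §2] [cite: Krajicek1995, §9.2] -/
theorem distAll (hG : CRulesOK G) (hk : k.Rules G) (sh : k.DistShape O A B C Q R QQ PP PR) (av : k.DistAvail O A B C Q R QQ PP PR K Γ)
    (hsB : ∀ j ≤ W, LtN W K Γ (k.s B j) (on W O)) (htB : ∀ j ≤ W, LtN W K Γ (k.t B j) (on W O))
    (hsC : ∀ j ≤ W, LtN W K Γ (k.s C j) (on W O)) (htC : ∀ j ≤ W, LtN W K Γ (k.t C j) (on W O)) (hg : GlobW W k.m K Γ (on W O)) :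
    ∀ j ≤ W, ∃ Δ : Set (PropForm ℕ), G.Yields Γ Δ ((j + 1) * k.distStep W K.size) ∧
      Holds K (Γ ∪ Δ) (eqW (k.s A j) (k.res (Q j)) W) ∧ Holds K (Γ ∪ Δ) (eqW (k.t A j) (k.res (R j)) W)
  | 0, _ => by
    have hΓ : ∀ {X : Set (PropForm ℕ)}, Γ ⊆ Γ ∪ X := fun {X} => Set.subset_union_left
    -- `s^A_0 = res O = res Q_0` by congruence of `O` and `Q_0`
    have b1 := (Yields.eqW_refl hG.adder K O.inp W (Γ := Γ)).union (Yields.eqW_refl hG.adder K (fun i => O.inp (W + i)) W)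
    set A1 := ctxSet K (eqW O.inp O.inp W) ∪ ctxSet K (eqW (fun i => O.inp (W + i)) (fun i => O.inp (W + i)) W) with hA1
    have b2 := resLeib hG (K := K) (Γ := Γ ∪ A1) (av.hO.mono hΓ) ((av.hQ 0 (Nat.zero_le W)).mono hΓ) (x := O.inp) (y := fun i => O.inp (W + i))
      (nw := on W O) (x' := O.inp) (y' := fun i => O.inp (W + i)) (fun _ _ => rfl) (fun _ _ => rfl) (fun _ _ => rfl)
      (fun i hi => by rw [sh.hQx 0 (Nat.zero_le W) i hi]; exact sh.hBa i hi) (fun i hi => by rw [sh.hQy 0 (Nat.zero_le W) i hi]; exact sh.hCa i hi)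
      (fun i hi => sh.hQn 0 (Nat.zero_le W) i hi) (holds_ctxSet fun θ hθ => Or.inr (Or.inl hθ)) (holds_ctxSet fun θ hθ => Or.inr (Or.inr hθ))
    set A2 := A1 ∪ ctxSet K (eqW (k.res O) (k.res (Q 0)) W) with hA2
    -- `t^A_0 = e = res R_0`: literals of the constants, the unit law on `R_0 = e ∘ t^C_0`
    have b3 := ((Chain.lits_of_cstDefs hG (w := k.t A 0) (fun i hi => hΓ (X := A2) (av.cvA.cst i hi))).union
      (Chain.lits_of_cstDefs hG (w := k.t B 0) fun i hi => hΓ (av.cvB.cst i hi))).union (Chain.lits_of_cstDefs hG (w := k.t C 0) fun i hi => hΓ (av.cvC.cst i hi))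
    set A3 := A2 ∪ ((ctxSet K (litW (k.t A 0) k.e W) ∪ ctxSet K (litW (k.t B 0) k.e W)) ∪ ctxSet K (litW (k.t C 0) k.e W)) with hA3
    obtain ⟨aU, haU, hwU⟩ := av.uR
    have b4 := k.unitL hk (Γ := Γ ∪ A3) ((av.hR 0 (Nat.zero_le W)).mono hΓ) (haU.mono hΓ) hwU
      (holds_litW_congr (holds_ctxSet fun θ hθ => Or.inr (Or.inr (Or.inl (Or.inr hθ)))) fun i hi => sh.hRx 0 (Nat.zero_le W) i hi)
      (((htC 0 (Nat.zero_le W)).mono hΓ).congr (fun i hi => sh.hRy 0 (Nat.zero_le W) i hi) fun i hi => sh.hRn 0 (Nat.zero_le W) i hi)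
      ((hg.mono hΓ).congr fun i hi => sh.hRn 0 (Nat.zero_le W) i hi)
    set A4 := A3 ∪ ctxSet K (eqW (k.res (R 0)) (oy W (R 0)) W) with hA4
    have b5 := Yields.eqW_symm hG.logic (K := K) (Γ := Γ ∪ A4) (a := k.res (R 0)) (b := oy W (R 0)) (W := W) (holds_ctxSet fun θ hθ => Or.inr (Or.inr hθ))
    set A5 := A4 ∪ ctxSet K (eqW (oy W (R 0)) (k.res (R 0)) W) with hA5
    have b6 := Yields.litW_transport hG.logic (K := K) (Γ := Γ ∪ A5) (a := oy W (R 0)) (b := k.res (R 0)) (bits := k.e) (W := W)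
      (holds_litW_congr (holds_ctxSet fun θ hθ => Or.inr (Or.inl (Or.inl (Or.inr (Or.inr hθ))))) fun i hi => sh.hRy 0 (Nat.zero_le W) i hi)
      (holds_ctxSet fun θ hθ => Or.inr (Or.inr hθ))
    set A6 := A5 ∪ ctxSet K (litW (k.res (R 0)) k.e W) with hA6
    have b7 := Yields.eqW_of_litW hG.logic (K := K) (Γ := Γ ∪ A6) (a := k.t A 0) (b := k.res (R 0)) (bits := k.e) (W := W)
      (holds_ctxSet fun θ hθ => Or.inr (Or.inl (Or.inl (Or.inl (Or.inr (Or.inl (Or.inl hθ))))))) (holds_ctxSet fun θ hθ => Or.inr (Or.inr hθ))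
    refine ⟨_, ((((((b1.trans b2).trans b3).trans b4).trans b5).trans b6).trans b7).mono_size ?_, ?_, holds_ctxSet fun θ hθ => Or.inr (Or.inr hθ)⟩
    · unfold distStep; nlinarith [Nat.zero_le W, Nat.zero_le K.size, Nat.zero_le (k.medC.1 * (K.size + k.medC.2)), Nat.zero_le k.T.length,
        Nat.zero_le (k.unitC.1 * (K.size + k.unitC.2))]
    · exact holds_eqW_iff.2 fun i hi => by
        rw [show k.s A 0 i = k.res O i from sh.hAa i hi]
        exact Or.inr (Or.inl (Or.inl (Or.inl (Or.inl (Or.inl (Or.inr (mem_ctxSet (mem_eqW hi))))))))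
  | j + 1, hj => by
    obtain ⟨Δ, hY, hIs, hIt⟩ := distAll hG hk sh av hsB htB hsC htC hg j (by omega)
    have hjW : j < W := by omega
    have hΓ : ∀ {X : Set (PropForm ℕ)}, Γ ∪ Δ ⊆ Γ ∪ Δ ∪ X := fun {X} => Set.subset_union_left
    have av' := av.mono (Set.subset_union_left (t := Δ))
    -- d1: `s^A_{j+1} = res QQ_j` by congruence of `S^A_j` and `QQ_j`
    have d1 := resLeib hG (K := K) (Γ := Γ ∪ Δ) (av'.cvA.S j hjW) (av'.hQQ j hjW) (x := k.s A j) (y := k.s A j) (nw := on W O) (x' := k.res (Q j))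
      (y' := k.res (Q j)) (fun i hi => So_x hi) (fun i hi => So_y hi) (fun i hi => by rw [So_n]; exact sh.hAn i hi) (sh.hQQx j hjW) (sh.hQQy j hjW)
      (sh.hQQn j hjW) hIs hIs
    set B1 := ctxSet K (eqW (k.res (k.So A j)) (k.res (QQ j)) W) with hB1
    -- d2: the medial law: `res QQ_j = res Q_{j+1}`
    obtain ⟨a1, ha1, hw1⟩ := av.m1 j hjW
    have d2 := k.medial hk (K := K) (Γ := Γ ∪ Δ ∪ B1) (os := k.os1 B C Q QQ j) (a := a1) (fun r hr => ?_) (mShape1 sh hjW) ((ha1.mono Set.subset_union_left).mono hΓ) hw1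
      ((((hsB j hjW.le).mono Set.subset_union_left).mono hΓ).congr (fun i hi => sh.hQx j hjW.le i hi) fun i hi => sh.hQn j hjW.le i hi)
      ((((hsC j hjW.le).mono Set.subset_union_left).mono hΓ).congr (fun i hi => sh.hQy j hjW.le i hi) fun i hi => sh.hQn j hjW.le i hi)
      ((((hsB j hjW.le).mono Set.subset_union_left).mono hΓ).congr (fun i hi => sh.hQx j hjW.le i hi) fun i hi => sh.hQn j hjW.le i hi)
      ((((hsC j hjW.le).mono Set.subset_union_left).mono hΓ).congr (fun i hi => sh.hQy j hjW.le i hi) fun i hi => sh.hQn j hjW.le i hi)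
      (((hg.mono Set.subset_union_left).mono hΓ).congr fun i hi => sh.hQn j hjW.le i hi)
    swap
    · obtain rfl | rfl | rfl | rfl | rfl | rfl : r = 0 ∨ r = 1 ∨ r = 2 ∨ r = 3 ∨ r = 4 ∨ r = 5 := by omega
      · exact ((av'.hQ j hjW.le).mono hΓ)
      · exact ((av'.hQ j hjW.le).mono hΓ)
      · exact ((av'.hQQ j hjW).mono hΓ)
      · exact ((av'.cvB.S j hjW).mono hΓ)
      · exact ((av'.cvC.S j hjW).mono hΓ)
      · exact ((av'.hQ (j + 1) hj).mono hΓ)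
    set B2 := B1 ∪ ctxSet K (eqW (k.res (QQ j)) (k.res (Q (j + 1))) W) with hB2
    have d2' := Yields.eqW_trans hG.logic (K := K) (Γ := Γ ∪ Δ ∪ B2) (a := k.s A (j + 1)) (b := k.res (QQ j)) (d := k.res (Q (j + 1))) (W := W)
      (holds_ctxSet fun θ hθ => Or.inr (Or.inl hθ)) (holds_ctxSet fun θ hθ => Or.inr (Or.inr hθ))
    set B3 := B2 ∪ ctxSet K (eqW (k.s A (j + 1)) (k.res (Q (j + 1))) W) with hB3
    -- d3: `p^A_j = res PP_j` by congruence of `P^A_j` and `PP_j`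
    have d3 := resLeib hG (K := K) (Γ := Γ ∪ Δ ∪ B3) ((av'.cvA.P j hjW).mono hΓ) ((av'.hPP j hjW).mono hΓ) (x := k.t A j) (y := k.s A j) (nw := on W O)
      (x' := k.res (R j)) (y' := k.res (Q j)) (fun i hi => Po_x hi) (fun i hi => Po_y hi) (fun i hi => by rw [Po_n]; exact sh.hAn i hi) (sh.hPPx j hjW)
      (sh.hPPy j hjW) (sh.hPPn j hjW) (hIt.mono hΓ) (hIs.mono hΓ)
    set B4 := B3 ∪ ctxSet K (eqW (k.res (k.Po A j)) (k.res (PP j)) W) with hB4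
    -- d4: the medial law: `res PP_j = res PR_j`
    obtain ⟨a2, ha2, hw2⟩ := av.m2 j hjW
    have d4 := k.medial hk (K := K) (Γ := Γ ∪ Δ ∪ B4) (os := k.os2 B C Q R PP PR j) (a := a2) (fun r hr => ?_) (mShape2 sh hjW) ((ha2.mono Set.subset_union_left).mono hΓ) hw2
      ((((htB j hjW.le).mono Set.subset_union_left).mono hΓ).congr (fun i hi => sh.hRx j hjW.le i hi) fun i hi => sh.hRn j hjW.le i hi)
      ((((htC j hjW.le).mono Set.subset_union_left).mono hΓ).congr (fun i hi => sh.hRy j hjW.le i hi) fun i hi => sh.hRn j hjW.le i hi)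
      ((((hsB j hjW.le).mono Set.subset_union_left).mono hΓ).congr (fun i hi => sh.hQx j hjW.le i hi) fun i hi => sh.hRn j hjW.le i hi)
      ((((hsC j hjW.le).mono Set.subset_union_left).mono hΓ).congr (fun i hi => sh.hQy j hjW.le i hi) fun i hi => sh.hRn j hjW.le i hi)
      (((hg.mono Set.subset_union_left).mono hΓ).congr fun i hi => sh.hRn j hjW.le i hi)
    swap
    · obtain rfl | rfl | rfl | rfl | rfl | rfl : r = 0 ∨ r = 1 ∨ r = 2 ∨ r = 3 ∨ r = 4 ∨ r = 5 := by omega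
      · exact ((av'.hR j hjW.le).mono hΓ)
      · exact ((av'.hQ j hjW.le).mono hΓ)
      · exact ((av'.hPP j hjW).mono hΓ)
      · exact ((av'.cvB.P j hjW).mono hΓ)
      · exact ((av'.cvC.P j hjW).mono hΓ)
      · exact ((av'.hPR j hjW).mono hΓ)
    set B5 := B4 ∪ ctxSet K (eqW (k.res (PP j)) (k.res (PR j)) W) with hB5
    have d4' := Yields.eqW_trans hG.logic (K := K) (Γ := Γ ∪ Δ ∪ B5) (a := k.p A j) (b := k.res (PP j)) (d := k.res (PR j)) (W := W)
      (holds_ctxSet fun θ hθ => Or.inr (Or.inl (Or.inr hθ))) (holds_ctxSet fun θ hθ => Or.inr (Or.inr hθ))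
    set B6 := B5 ∪ ctxSet K (eqW (k.p A j) (k.res (PR j)) W) with hB6
    -- d5: `n` is its own multiplexer; naturality on `R_{j+1}`, `PR_j`, `R_j`
    have d5 := Chain.muxSame hG (K := K) (Γ := Γ ∪ Δ ∪ B6) (B.inp (W + j)) (on W O) W
    set B7 := B6 ∪ ctxSet K (muxRelW (B.inp (W + j)) (on W O) (on W O) (on W O) W) with hB7
    have d6 : G.Yields (Γ ∪ Δ ∪ B7) (ctxSet K ((List.range k.T.length).map fun g =>
        muxRel (B.inp (W + j)) (((R (j + 1)).inst (3 * W)).wire g) (((PR j).inst (3 * W)).wire g) (((R j).inst (3 * W)).wire g))) (k.T.length * (K.size + 24)) := by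
      refine Yields.muxNat hG.muxNat k.wf _ _ _ K (B.inp (W + j)) ((av'.hR (j + 1) hj).mono hΓ) ((av'.hPR j hjW).mono hΓ) ((av'.hR j hjW.le).mono hΓ) fun q hq => ?_
      rw [(R (j + 1)).getD_inst hq, (PR j).getD_inst hq, (R j).getD_inst hq]
      by_cases h1 : q < W
      · rw [sh.hRx (j + 1) hj q h1, sh.hPRx j hjW q h1, sh.hRx j hjW.le q h1]; exact Or.inl (Or.inl (av.cvB.mux j hjW q h1))
      · by_cases h2 : q < 2 * W
        · obtain ⟨i, rfl⟩ : ∃ i, q = W + i := ⟨q - W, by omega⟩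
          rw [sh.hRy (j + 1) hj i (by omega), sh.hPRy j hjW i (by omega), sh.hRy j hjW.le i (by omega), ← sh.hCb j hjW]
          exact Or.inl (Or.inl (av.cvC.mux j hjW i (by omega)))
        · obtain ⟨i, rfl⟩ : ∃ i, q = 2 * W + i := ⟨q - 2 * W, by omega⟩
          rw [sh.hRn (j + 1) hj i (by omega), sh.hPRn j hjW i (by omega), sh.hRn j hjW.le i (by omega)]
          exact Or.inr (Or.inr (mem_ctxSet (List.mem_map.2 ⟨i, List.mem_range.2 (by omega), rfl⟩)))
    set B8 := B7 ∪ ctxSet K ((List.range k.T.length).map fun g =>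
      muxRel (B.inp (W + j)) (((R (j + 1)).inst (3 * W)).wire g) (((PR j).inst (3 * W)).wire g) (((R j).inst (3 * W)).wire g)) with hB8
    -- d7: the multiplexer of `A` in terms of `res PR_j`, `res R_j`; functionality
    have d7 := Chain.muxCongrW hG (K := K) (Γ := Γ ∪ Δ ∪ B8) (g := B.inp (W + j)) (w := k.t A (j + 1)) (w₁ := k.p A j) (w₂ := k.t A j)
      (w₁' := k.res (PR j)) (w₂' := k.res (R j)) (W := W)
      (holds_muxRelW_iff.2 fun i hi => by rw [← sh.hAb j hjW]; exact Or.inl (Or.inl (av.cvA.mux j hjW i hi)))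
      (holds_ctxSet fun θ hθ => Or.inr (Or.inl (Or.inl (Or.inr hθ)))) ((hIt.mono hΓ))
    set B9 := B8 ∪ ctxSet K (muxRelW (B.inp (W + j)) (k.t A (j + 1)) (k.res (PR j)) (k.res (R j)) W) with hB9
    have d8 := Chain.muxFunW hG (K := K) (Γ := Γ ∪ Δ ∪ B9) (g := B.inp (W + j)) (w := k.t A (j + 1)) (w' := k.res (R (j + 1))) (w₁ := k.res (PR j))
      (w₂ := k.res (R j)) (W := W) (holds_ctxSet fun θ hθ => Or.inr (Or.inr hθ))
      (holds_muxRelW_iff.2 fun i hi => Or.inr (Or.inl (Or.inr (mem_ctxSet (List.mem_map.2 ⟨k.resOff i, List.mem_range.2 (k.resOff_lt i hi), rfl⟩)))))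
    have h := (((((((((d1.trans d2).trans d2').trans d3).trans d4).trans d4').trans d5).trans d6).trans d7).trans d8)
    refine ⟨Δ ∪ (B9 ∪ ctxSet K (eqW (k.t A (j + 1)) (k.res (R (j + 1))) W)), (hY.trans h).mono_size ?_, ?_, ?_⟩
    · unfold distStep
      nlinarith [Nat.zero_le W, Nat.zero_le K.size, Nat.zero_le (k.medC.1 * (K.size + k.medC.2)), Nat.zero_le k.T.length, Nat.zero_le j,
        Nat.zero_le (k.unitC.1 * (K.size + k.unitC.2))]
    · exact holds_ctxSet fun θ hθ => Or.inr (Or.inr (Or.inl (Or.inl (Or.inl (Or.inl (Or.inl (Or.inl (Or.inl (Or.inr hθ)))))))))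
    · exact holds_ctxSet fun θ hθ => Or.inr (Or.inr (Or.inr hθ))

end OpKit

end ModAdd

end Literature.Computability.MetaComplexity

/-!
# Chains over an operation kit: the swap law `CH(CH(a, r), v) = CH(CH(a, v), r)`

Layer E/6 of the `EF`-proof construction kit. Over multiplication the chain is exponentiation and
the law is `(a ^ r) ^ v = (a ^ v) ^ r`; over modular addition it is `(a · r) · v = (a · v) · r`.
Inside Frege (`OpKit.swapAll`, `OpKit.swap`): the map `h = CH(·, v)` is applied to every node of
the chain `A₁ = CH(a, r)` — occurrences `Hs_j = CH(s¹_j, v)`, `Ht_j = CH(t¹_j, v)`,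
`Hp_j = CH(p¹_j, v)` — and one proves along `j` that the results of `Hs_j`, `Ht_j` are the nodes
`s⁴_j`, `t⁴_j` of `A₄ = CH(CH(a, v), r)`: the step for `s` is the distributivity law
(`EFChainLaws.lean`) on `s¹_{j+1} = s¹_j ∘ s¹_j`, the step for `t` is distributivity on
`p¹_j = t¹_j ∘ s¹_j` and multiplexer naturality on the whole chain template
(`t¹_{j+1} = r_j ? p¹_j : t¹_j`); the base uses the chain of the unit (`EFChainLaws.lean`) and
congruence (`Hs_0 = CH(a, v) = A₃`). Finally `A₂ = CH(res A₁, v) = Ht_W` by congruence.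

## Sources

* S. A. Cook, R. A. Reckhow, *The relative efficiency of propositional proof systems*,
  J. Symbolic Logic 44 (1979), §2.
* J. Krajíček, *Bounded Arithmetic, Propositional Logic, and Complexity Theory* (CUP 1995), §9.2.
-/

namespace Literature.Computability.MetaComplexity

open _root_.Computability Complexity Complexity.PropForm FregeSystem Netlist

namespace ModAdd

namespace OpKit

variable {W : ℕ} (k : OpKit W)

/-- Offset of the bit `i` of `t_j` inside the chain template. [folklore] -/
def tOff : ℕ → ℕ → ℕ
  | 0, i => i
  | j + 1, i => k.offS j + 2 * k.T.length + i

/-- The word `t_j` in terms of offsets. [folklore] -/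
theorem t_eq (o : Occ) (j i : ℕ) : k.t o j i = o.base + k.tOff j i := by cases j <;> simp [t, tOff, Nat.add_assoc]

/-- The offsets of `t_j` (`j ≤ W`, `i < W`) are gates of the chain template. [folklore] -/
theorem tOff_lt {j i : ℕ} (hj : j ≤ W) (hi : i < W) : k.tOff j i < k.chainT.length := by
  rw [length_chainT]
  cases j with
  | zero => simp [tOff, offS]; omega
  | succ j =>
    simp only [tOff]
    have : k.offS j + 2 * k.T.length + W ≤ k.offS W := by
      rw [← offS_succ]; unfold offS; exact Nat.add_le_add_left (Nat.mul_le_mul_right _ hj) _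
    omega

/-- `SwapShape`: the wiring of the occurrences of the swap law. `A₁ = CH(a, r)`, `A₃ = CH(a, v)`,
`A₄ = CH(res A₃, r)`, `A₂ = CH(res A₁, v)`; `Hs_j = CH(s¹_j, v)`, `Ht_j = CH(t¹_j, v)` (`j ≤ W`),
`Hp_j = CH(p¹_j, v)` (`j < W`); all with the `n` of `A₁`. [folklore] -/
structure SwapShape (A₁ A₂ A₃ A₄ : Occ) (Hs Ht Hp : ℕ → Occ) : Prop where
  /-- `A₂` reads `res A₁` -/
  hA2x : ∀ i < W, A₂.inp i = k.t A₁ W i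
  /-- `A₂` reads `v` -/
  hA2y : ∀ i < W, A₂.inp (W + i) = A₃.inp (W + i)
  /-- same `n` -/
  hA2n : ∀ i < W, A₂.inp (2 * W + i) = A₁.inp (2 * W + i)
  /-- `A₃` reads `a` -/
  hA3x : ∀ i < W, A₃.inp i = A₁.inp i
  /-- same `n` -/
  hA3n : ∀ i < W, A₃.inp (2 * W + i) = A₁.inp (2 * W + i)
  /-- `A₄` reads `res A₃` -/
  hA4x : ∀ i < W, A₄.inp i = k.t A₃ W i
  /-- `A₄` reads `r` -/
  hA4y : ∀ j < W, A₄.inp (W + j) = A₁.inp (W + j)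
  /-- same `n` -/
  hA4n : ∀ i < W, A₄.inp (2 * W + i) = A₁.inp (2 * W + i)
  /-- `Hs_j` -/
  hHsx : ∀ j ≤ W, ∀ i < W, (Hs j).inp i = k.s A₁ j i
  /-- `Hs_j` reads `v` -/
  hHsy : ∀ j ≤ W, ∀ i < W, (Hs j).inp (W + i) = A₃.inp (W + i)
  /-- same `n` -/
  hHsn : ∀ j ≤ W, ∀ i < W, (Hs j).inp (2 * W + i) = A₁.inp (2 * W + i)
  /-- `Ht_j` -/
  hHtx : ∀ j ≤ W, ∀ i < W, (Ht j).inp i = k.t A₁ j i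
  /-- `Ht_j` reads `v` -/
  hHty : ∀ j ≤ W, ∀ i < W, (Ht j).inp (W + i) = A₃.inp (W + i)
  /-- same `n` -/
  hHtn : ∀ j ≤ W, ∀ i < W, (Ht j).inp (2 * W + i) = A₁.inp (2 * W + i)
  /-- `Hp_j` -/
  hHpx : ∀ j < W, ∀ i < W, (Hp j).inp i = k.p A₁ j i
  /-- `Hp_j` reads `v` -/
  hHpy : ∀ j < W, ∀ i < W, (Hp j).inp (W + i) = A₃.inp (W + i)
  /-- same `n` -/
  hHpn : ∀ j < W, ∀ i < W, (Hp j).inp (2 * W + i) = A₁.inp (2 * W + i)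

/-- `SwapAvail`: the chain occurrences of the swap law are available. [folklore] -/
structure SwapAvail (A₁ A₂ A₃ A₄ : Occ) (Hs Ht Hp : ℕ → Occ) (K : PropForm ℕ) (Γ : Set (PropForm ℕ)) : Prop where
  /-- `A₁` -/
  cv₁ : k.ChainViews A₁ K Γ
  /-- `A₂` -/
  hA2 : A₂.Avail k.chainT (3 * W) K Γ
  /-- `A₃` -/
  hA3 : A₃.Avail k.chainT (3 * W) K Γ
  /-- `A₄` -/
  cv₄ : k.ChainViews A₄ K Γ
  /-- `Hs_0` -/
  hHs0 : (Hs 0).Avail k.chainT (3 * W) K Γ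
  /-- `Ht_j` -/
  hHt : ∀ j ≤ W, (Ht j).Avail k.chainT (3 * W) K Γ
  /-- `Hp_j` -/
  hHp : ∀ j < W, (Hp j).Avail k.chainT (3 * W) K Γ

variable {k}
variable {A₁ A₂ A₃ A₄ : Occ} {Hs Ht Hp : ℕ → Occ} {G : FregeSystem} {K : PropForm ℕ} {Γ : Set (PropForm ℕ)}

/-- Availability of the swap data is monotone. [folklore] -/
theorem SwapAvail.mono {Γ' : Set (PropForm ℕ)} (h : k.SwapAvail A₁ A₂ A₃ A₄ Hs Ht Hp K Γ) (hΓ : Γ ⊆ Γ') : k.SwapAvail A₁ A₂ A₃ A₄ Hs Ht Hp K Γ' :=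
  ⟨h.cv₁.mono hΓ, h.hA2.mono hΓ, h.hA3.mono hΓ, h.cv₄.mono hΓ, h.hHs0.mono hΓ, fun j hj => (h.hHt j hj).mono hΓ, fun j hj => (h.hHp j hj).mono hΓ⟩

/-- **Congruence of two chain occurrences**: provably equal operand words and the same `n` give
provably equal results `t_W`. [cite: CookReckhow1979, §2] -/
theorem chainLeib (hG : CRulesOK G) {o o' : Occ} (ho : o.Avail k.chainT (3 * W) K Γ) (ho' : o'.Avail k.chainT (3 * W) K Γ) {x y x' y' nw : ℕ → ℕ}
    (hx : ∀ i < W, o.inp i = x i) (hy : ∀ i < W, o.inp (W + i) = y i) (hn : ∀ i < W, o.inp (2 * W + i) = nw i)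
    (hx' : ∀ i < W, o'.inp i = x' i) (hy' : ∀ i < W, o'.inp (W + i) = y' i) (hn' : ∀ i < W, o'.inp (2 * W + i) = nw i)
    (hex : Holds K Γ (eqW x x' W)) (hey : Holds K Γ (eqW y y' W)) :
    G.Yields Γ (ctxSet K (eqW (k.t o W) (k.t o' W) W)) ((k.chainT.length + 2 * W) * (K.size + 10)) := by
  have r1 := Yields.eqW_refl hG.adder K nw W (Γ := Γ)
  have r2 : G.Yields (Γ ∪ ctxSet K (eqW nw nw W)) {χ | χ ∈ leibLines (o.inst (3 * W)) (o'.inst (3 * W)) K k.chainT.length} (k.chainT.length * (K.size + 10)) := by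
    refine occLeib hG.netlist k.wf_chainT o o' (ho.mono Set.subset_union_left) (ho'.mono Set.subset_union_left) fun q hq => ?_
    by_cases h1 : q < W
    · rw [hx q h1, hx' q h1]; exact Or.inl (holds_eqW_iff.1 hex q h1)
    · by_cases h2 : q < 2 * W
      · obtain ⟨i, rfl⟩ : ∃ i, q = W + i := ⟨q - W, by omega⟩
        rw [hy i (by omega), hy' i (by omega)]; exact Or.inl (holds_eqW_iff.1 hey i (by omega))
      · obtain ⟨i, rfl⟩ : ∃ i, q = 2 * W + i := ⟨q - 2 * W, by omega⟩
        rw [hn i (by omega), hn' i (by omega)]; exact Or.inr (mem_ctxSet (mem_eqW (by omega)))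
  refine ((r1.trans r2).mono_right ?_).mono_size (by nlinarith [Nat.zero_le W, Nat.zero_le K.size, Nat.zero_le k.chainT.length])
  rintro θ ⟨L, hL, rfl⟩
  obtain ⟨i, hi, rfl⟩ := List.mem_map.1 hL
  rw [t_eq, t_eq]
  exact Or.inr (wire_mem_occLeib (k.tOff_lt le_rfl (List.mem_range.1 hi)))

variable (k) in
/-- The size of one step of the swap law. [folklore] -/
def swapStep (W ks : ℕ) : ℕ := 2 * ((W + 1) * k.distStep W ks) + (3 * k.chainT.length + 2 * k.T.length + 20 * W + 8) * (ks + 24)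

variable (k) in
/-- The size of the base of the swap law. [folklore] -/
def swapBase (W ks : ℕ) : ℕ := (W + 1) * k.domStep W ks + (W + 1) * k.unitStep W ks + (k.chainT.length + 8 * W) * (ks + 10)

/-- **The swap law along the nodes.** Under the swap data, the distributivity data of every step
(two instances: on `s¹_{j+1} = s¹_j ∘ s¹_j` with `B = C = Hs_j`, and on `p¹_j = t¹_j ∘ s¹_j` with
`B = Ht_j`, `C = Hs_j`), the domain facts of the nodes of the `Hs_j`, `Ht_j` and of `A₁`, the domain
and unit support of `Ht_0` and the global facts: for all `j ≤ W`, `res Hs_j = s⁴_j` and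
`res Ht_j = t⁴_j`. [cite: CookReckhow1979, §2] [cite: Krajicek1995, §9.2] -/
theorem swapAll (hG : CRulesOK G) (hk : k.Rules G) (sh : k.SwapShape A₁ A₂ A₃ A₄ Hs Ht Hp) (av : k.SwapAvail A₁ A₂ A₃ A₄ Hs Ht Hp K Γ)
    {Qs Rs QQs PPs PRs Qp Rp QQp PPp PRp : ℕ → ℕ → Occ}
    (shS : ∀ j < W, k.DistShape (k.So A₁ j) (Hs (j + 1)) (Hs j) (Hs j) (Qs j) (Rs j) (QQs j) (PPs j) (PRs j))
    (avS : ∀ j < W, k.DistAvail (k.So A₁ j) (Hs (j + 1)) (Hs j) (Hs j) (Qs j) (Rs j) (QQs j) (PPs j) (PRs j) K Γ)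
    (shP : ∀ j < W, k.DistShape (k.Po A₁ j) (Hp j) (Ht j) (Hs j) (Qp j) (Rp j) (QQp j) (PPp j) (PRp j))
    (avP : ∀ j < W, k.DistAvail (k.Po A₁ j) (Hp j) (Ht j) (Hs j) (Qp j) (Rp j) (QQp j) (PPp j) (PRp j) K Γ)
    (domHs : ∀ j ≤ W, ∀ j' ≤ W, LtN W K Γ (k.s (Hs j) j') (on W A₁) ∧ LtN W K Γ (k.t (Hs j) j') (on W A₁))
    (domHt : ∀ j ≤ W, ∀ j' ≤ W, LtN W K Γ (k.s (Ht j) j') (on W A₁) ∧ LtN W K Γ (k.t (Ht j) j') (on W A₁))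
    (ht1 : ∀ j ≤ W, LtN W K Γ (k.t A₁ j) (on W A₁)) {Dt0 : ℕ → Sub.View} (cvT0 : k.ChainViews (Ht 0) K Γ)
    (dsT0 : k.DomSupport (Ht 0) Dt0 K Γ) (usT0 : k.UnitSupport (Ht 0) K Γ) (hg : GlobW W k.m K Γ (on W A₁)) :
    ∀ j ≤ W, ∃ Δ : Set (PropForm ℕ), G.Yields Γ Δ (k.swapBase W K.size + j * k.swapStep W K.size) ∧
      Holds K (Γ ∪ Δ) (eqW (k.t (Hs j) W) (k.s A₄ j) W) ∧ Holds K (Γ ∪ Δ) (eqW (k.t (Ht j) W) (k.t A₄ j) W)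
  | 0, _ => by
    have hΓ : ∀ {X : Set (PropForm ℕ)}, Γ ⊆ Γ ∪ X := fun {X} => Set.subset_union_left
    -- `res Hs_0 = res A₃ = s⁴_0` by congruence of `Hs_0` and `A₃`
    have b1 := (Yields.eqW_refl hG.adder K A₁.inp W (Γ := Γ)).union (Yields.eqW_refl hG.adder K (fun i => A₃.inp (W + i)) W)
    set A1 := ctxSet K (eqW A₁.inp A₁.inp W) ∪ ctxSet K (eqW (fun i => A₃.inp (W + i)) (fun i => A₃.inp (W + i)) W) with hA1
    have b2 := chainLeib hG (K := K) (Γ := Γ ∪ A1) (av.hHs0.mono hΓ) (av.hA3.mono hΓ) (x := A₁.inp) (y := fun i => A₃.inp (W + i)) (nw := on W A₁)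
      (x' := A₁.inp) (y' := fun i => A₃.inp (W + i)) (fun i hi => sh.hHsx 0 (Nat.zero_le W) i hi) (fun i hi => sh.hHsy 0 (Nat.zero_le W) i hi)
      (fun i hi => sh.hHsn 0 (Nat.zero_le W) i hi) sh.hA3x (fun _ _ => rfl) sh.hA3n (holds_ctxSet fun θ hθ => Or.inr (Or.inl hθ))
      (holds_ctxSet fun θ hθ => Or.inr (Or.inr hθ))
    set A2 := A1 ∪ ctxSet K (eqW (k.t (Hs 0) W) (k.t A₃ W) W) with hA2
    -- the literals of `t¹_0` and `t⁴_0`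
    have b3 := (Chain.lits_of_cstDefs hG (w := k.t A₁ 0) (fun i hi => hΓ (X := A2) (av.cv₁.cst i hi))).union
      (Chain.lits_of_cstDefs hG (w := k.t A₄ 0) fun i hi => hΓ (av.cv₄.cst i hi))
    set A3 := A2 ∪ (ctxSet K (litW (k.t A₁ 0) k.e W) ∪ ctxSet K (litW (k.t A₄ 0) k.e W)) with hA3
    -- `res Ht_0 = e` by the chain of the unit
    obtain ⟨Δu, hYu, -, htl, -, -⟩ := unitChain hG hk (cvT0.mono (hΓ (X := A3))) (dsT0.mono hΓ) (usT0.mono hΓ)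
      (((ht1 0 (Nat.zero_le W)).mono hΓ).congr (fun i hi => sh.hHtx 0 (Nat.zero_le W) i hi) fun i hi => sh.hHtn 0 (Nat.zero_le W) i hi)
      ((hg.mono hΓ).congr fun i hi => sh.hHtn 0 (Nat.zero_le W) i hi)
      (holds_litW_congr (holds_ctxSet fun θ hθ => Or.inr (Or.inr (Or.inl hθ))) fun i hi => sh.hHtx 0 (Nat.zero_le W) i hi)
    -- `res Ht_0 = t⁴_0`
    have b5 := Yields.eqW_of_litW hG.logic (K := K) (Γ := Γ ∪ A3 ∪ Δu) (a := k.t (Ht 0) W) (b := k.t A₄ 0) (bits := k.e) (W := W) (htl W le_rfl)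
      (holds_ctxSet fun θ hθ => Or.inl (Or.inr (Or.inr (Or.inr hθ))))
    have h := ((b1.trans b2).trans b3).trans (hYu.trans b5)
    refine ⟨_, h.mono_size ?_, ?_, ?_⟩
    · unfold swapBase; nlinarith [Nat.zero_le W, Nat.zero_le K.size, Nat.zero_le (k.domStep W K.size), Nat.zero_le (k.unitStep W K.size), Nat.zero_le k.chainT.length]
    · refine holds_eqW_iff.2 fun i hi => ?_
      rw [show k.s A₄ 0 i = k.t A₃ W i from sh.hA4x i hi]
      exact Or.inr (Or.inl (Or.inl (Or.inr (mem_ctxSet (mem_eqW hi)))))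
    · exact holds_ctxSet fun θ hθ => Or.inr (Or.inr (Or.inr hθ))
  | j + 1, hj => by
    obtain ⟨Δ, hY, hJs, hJt⟩ := swapAll hG hk sh av shS avS shP avP domHs domHt ht1 cvT0 dsT0 usT0 hg j (by omega)
    have hjW : j < W := by omega
    have hΓ₀ : ∀ {X : Set (PropForm ℕ)}, Γ ∪ Δ ⊆ Γ ∪ Δ ∪ X := fun {X} => Set.subset_union_left
    have hΓ : Γ ⊆ Γ ∪ Δ := Set.subset_union_left
    have dHs : ∀ {T : Set (PropForm ℕ)}, Γ ⊆ T → ∀ j ≤ W, ∀ j' ≤ W, LtN W K T (k.s (Hs j) j') (on W A₁) ∧ LtN W K T (k.t (Hs j) j') (on W A₁) :=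
      fun hT j hj j' hj' => ⟨(domHs j hj j' hj').1.mono hT, (domHs j hj j' hj').2.mono hT⟩
    have dHt : ∀ {T : Set (PropForm ℕ)}, Γ ⊆ T → ∀ j ≤ W, ∀ j' ≤ W, LtN W K T (k.s (Ht j) j') (on W A₁) ∧ LtN W K T (k.t (Ht j) j') (on W A₁) :=
      fun hT j hj j' hj' => ⟨(domHt j hj j' hj').1.mono hT, (domHt j hj j' hj').2.mono hT⟩
    -- (1) distributivity on `s¹_{j+1} = s¹_j ∘ s¹_j`: `res Hs_{j+1} = res (Rs j W)`, `Rs j W = res Hs_j ∘ res Hs_j`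
    obtain ⟨Δ₁, hY₁, -, hS⟩ := distAll hG hk (shS j hjW) ((avS j hjW).mono hΓ)
      (fun j' hj' => ((dHs hΓ j hjW.le j' hj').1).congr (fun _ _ => rfl) fun i _ => So_n j i)
      (fun j' hj' => ((dHs hΓ j hjW.le j' hj').2).congr (fun _ _ => rfl) fun i _ => So_n j i)
      (fun j' hj' => ((dHs hΓ j hjW.le j' hj').1).congr (fun _ _ => rfl) fun i _ => So_n j i)
      (fun j' hj' => ((dHs hΓ j hjW.le j' hj').2).congr (fun _ _ => rfl) fun i _ => So_n j i)
      ((hg.mono hΓ).congr fun i _ => So_n j i) W le_rfl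
    -- (2) congruence `Rs j W ≅ S⁴_j`: `res (Rs j W) = s⁴_{j+1}`
    have d2 := resLeib hG (K := K) (Γ := Γ ∪ Δ ∪ Δ₁) (((avS j hjW).hR W le_rfl).mono (hΓ.trans Set.subset_union_left)) ((av.cv₄.S j hjW).mono (hΓ.trans Set.subset_union_left))
      (x := k.t (Hs j) W) (y := k.t (Hs j) W) (nw := on W A₁) (x' := k.s A₄ j) (y' := k.s A₄ j) ((shS j hjW).hRx W le_rfl) ((shS j hjW).hRy W le_rfl)
      (fun i hi => by rw [(shS j hjW).hRn W le_rfl i hi]; exact So_n j i) (fun i hi => So_x hi) (fun i hi => So_y hi) (fun i hi => by rw [So_n]; exact sh.hA4n i hi)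
      (hJs.mono Set.subset_union_left) (hJs.mono Set.subset_union_left)
    set B1 := ctxSet K (eqW (k.res (Rs j W)) (k.res (k.So A₄ j)) W) with hB1
    have d3 := Yields.eqW_trans hG.logic (K := K) (Γ := Γ ∪ Δ ∪ Δ₁ ∪ B1) (a := k.t (Hs (j + 1)) W) (b := k.res (Rs j W)) (d := k.s A₄ (j + 1)) (W := W)
      (hS.mono Set.subset_union_left) (holds_ctxSet Set.subset_union_right)
    set B2 := B1 ∪ ctxSet K (eqW (k.t (Hs (j + 1)) W) (k.s A₄ (j + 1)) W) with hB2
    -- (3) distributivity on `p¹_j = t¹_j ∘ s¹_j`: `res Hp_j = res (Rp j W)`, `Rp j W = res Ht_j ∘ res Hs_j`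
    have hΓ₂ : Γ ⊆ Γ ∪ Δ ∪ Δ₁ ∪ B2 := hΓ.trans (Set.subset_union_left.trans Set.subset_union_left)
    obtain ⟨Δ₂, hY₂, -, hP⟩ := distAll hG hk (shP j hjW) ((avP j hjW).mono hΓ₂)
      (fun j' hj' => ((dHt hΓ₂ j hjW.le j' hj').1).congr (fun _ _ => rfl) fun i _ => Po_n j i)
      (fun j' hj' => ((dHt hΓ₂ j hjW.le j' hj').2).congr (fun _ _ => rfl) fun i _ => Po_n j i)
      (fun j' hj' => ((dHs hΓ₂ j hjW.le j' hj').1).congr (fun _ _ => rfl) fun i _ => Po_n j i)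
      (fun j' hj' => ((dHs hΓ₂ j hjW.le j' hj').2).congr (fun _ _ => rfl) fun i _ => Po_n j i)
      ((hg.mono hΓ₂).congr fun i _ => Po_n j i) W le_rfl
    set Γ₃ := Γ ∪ Δ ∪ Δ₁ ∪ B2 ∪ Δ₂ with hΓ₃
    have hΓ₃Γ : Γ ⊆ Γ₃ := hΓ₂.trans Set.subset_union_left
    have hJs₃ : Holds K Γ₃ (eqW (k.t (Hs j) W) (k.s A₄ j) W) := hJs.mono (Set.subset_union_left.trans (Set.subset_union_left.trans Set.subset_union_left))
    have hJt₃ : Holds K Γ₃ (eqW (k.t (Ht j) W) (k.t A₄ j) W) := hJt.mono (Set.subset_union_left.trans (Set.subset_union_left.trans Set.subset_union_left))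
    -- (4) congruence `Rp j W ≅ P⁴_j`: `res (Rp j W) = p⁴_j`; hence `res Hp_j = p⁴_j`
    have d4 := resLeib hG (K := K) (Γ := Γ₃) (((avP j hjW).hR W le_rfl).mono hΓ₃Γ) ((av.cv₄.P j hjW).mono hΓ₃Γ)
      (x := k.t (Ht j) W) (y := k.t (Hs j) W) (nw := on W A₁) (x' := k.t A₄ j) (y' := k.s A₄ j) ((shP j hjW).hRx W le_rfl) ((shP j hjW).hRy W le_rfl)
      (fun i hi => by rw [(shP j hjW).hRn W le_rfl i hi]; exact Po_n j i) (fun i hi => Po_x hi) (fun i hi => Po_y hi) (fun i hi => by rw [Po_n]; exact sh.hA4n i hi)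
      hJt₃ hJs₃
    set C1 := ctxSet K (eqW (k.res (Rp j W)) (k.res (k.Po A₄ j)) W) with hC1
    have d5 := Yields.eqW_trans hG.logic (K := K) (Γ := Γ₃ ∪ C1) (a := k.t (Hp j) W) (b := k.res (Rp j W)) (d := k.p A₄ j) (W := W)
      (hP.mono Set.subset_union_left) (holds_ctxSet Set.subset_union_right)
    set C2 := C1 ∪ ctxSet K (eqW (k.t (Hp j) W) (k.p A₄ j) W) with hC2
    -- (5) `v` and `n` are their own multiplexers; naturality on `Ht_{j+1}`, `Hp_j`, `Ht_j`
    have d6 := (Chain.muxSame hG (K := K) (Γ := Γ₃ ∪ C2) (A₁.inp (W + j)) (fun i => A₃.inp (W + i)) W).union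
      (Chain.muxSame hG (K := K) (Γ := Γ₃ ∪ C2) (A₁.inp (W + j)) (on W A₁) W)
    set C3 := C2 ∪ (ctxSet K (muxRelW (A₁.inp (W + j)) (fun i => A₃.inp (W + i)) (fun i => A₃.inp (W + i)) (fun i => A₃.inp (W + i)) W) ∪
      ctxSet K (muxRelW (A₁.inp (W + j)) (on W A₁) (on W A₁) (on W A₁) W)) with hC3
    have d7 : G.Yields (Γ₃ ∪ C3) (ctxSet K ((List.range k.chainT.length).map fun g =>
        muxRel (A₁.inp (W + j)) (((Ht (j + 1)).inst (3 * W)).wire g) (((Hp j).inst (3 * W)).wire g) (((Ht j).inst (3 * W)).wire g)))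
        (k.chainT.length * (K.size + 24)) := by
      refine Yields.muxNat hG.muxNat k.wf_chainT _ _ _ K (A₁.inp (W + j)) ((av.hHt (j + 1) hj).mono (hΓ₃Γ.trans Set.subset_union_left))
        ((av.hHp j hjW).mono (hΓ₃Γ.trans Set.subset_union_left)) ((av.hHt j hjW.le).mono (hΓ₃Γ.trans Set.subset_union_left)) fun q hq => ?_
      rw [(Ht (j + 1)).getD_inst hq, (Hp j).getD_inst hq, (Ht j).getD_inst hq]
      by_cases h1 : q < W
      · rw [sh.hHtx (j + 1) hj q h1, sh.hHpx j hjW q h1, sh.hHtx j hjW.le q h1]; exact Or.inl (hΓ₃Γ (av.cv₁.mux j hjW q h1))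
      · by_cases h2 : q < 2 * W
        · obtain ⟨i, rfl⟩ : ∃ i, q = W + i := ⟨q - W, by omega⟩
          rw [sh.hHty (j + 1) hj i (by omega), sh.hHpy j hjW i (by omega), sh.hHty j hjW.le i (by omega)]
          exact Or.inr (Or.inr (Or.inl (mem_ctxSet (List.mem_map.2 ⟨i, List.mem_range.2 (by omega), rfl⟩))))
        · obtain ⟨i, rfl⟩ : ∃ i, q = 2 * W + i := ⟨q - 2 * W, by omega⟩
          rw [sh.hHtn (j + 1) hj i (by omega), sh.hHpn j hjW i (by omega), sh.hHtn j hjW.le i (by omega)]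
          exact Or.inr (Or.inr (Or.inr (mem_ctxSet (List.mem_map.2 ⟨i, List.mem_range.2 (by omega), rfl⟩))))
    set C4 := C3 ∪ ctxSet K ((List.range k.chainT.length).map fun g =>
      muxRel (A₁.inp (W + j)) (((Ht (j + 1)).inst (3 * W)).wire g) (((Hp j).inst (3 * W)).wire g) (((Ht j).inst (3 * W)).wire g)) with hC4
    -- (6) the result of `Ht_{j+1}` as a multiplexer of `p⁴_j`, `t⁴_j`; functionality with the multiplexer of `A₄`
    have d8 := Chain.muxCongrW hG (K := K) (Γ := Γ₃ ∪ C4) (g := A₁.inp (W + j)) (w := k.t (Ht (j + 1)) W) (w₁ := k.t (Hp j) W) (w₂ := k.t (Ht j) W)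
      (w₁' := k.p A₄ j) (w₂' := k.t A₄ j) (W := W)
      (holds_muxRelW_iff.2 fun i hi => by
        rw [t_eq, t_eq, t_eq]
        exact Or.inr (Or.inr (mem_ctxSet (List.mem_map.2 ⟨k.tOff W i, List.mem_range.2 (k.tOff_lt le_rfl hi), rfl⟩))))
      (holds_ctxSet fun θ hθ => Or.inr (Or.inl (Or.inl (Or.inr hθ)))) (hJt₃.mono Set.subset_union_left)
    set C5 := C4 ∪ ctxSet K (muxRelW (A₁.inp (W + j)) (k.t (Ht (j + 1)) W) (k.p A₄ j) (k.t A₄ j) W) with hC5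
    have d9 := Chain.muxFunW hG (K := K) (Γ := Γ₃ ∪ C5) (g := A₁.inp (W + j)) (w := k.t (Ht (j + 1)) W) (w' := k.t A₄ (j + 1)) (w₁ := k.p A₄ j) (w₂ := k.t A₄ j) (W := W)
      (holds_ctxSet fun θ hθ => Or.inr (Or.inr hθ)) (holds_muxRelW_iff.2 fun i hi => by rw [← sh.hA4y j hjW]; exact Or.inl (hΓ₃Γ (av.cv₄.mux j hjW i hi)))
    have hC := ((((d4.trans d5).trans d6).trans d7).trans d8).trans d9
    have h := hY.trans (hY₁.trans ((d2.trans d3).trans (hY₂.trans hC)))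
    refine ⟨_, h.mono_size ?_, ?_, ?_⟩
    · unfold swapStep
      nlinarith [Nat.zero_le W, Nat.zero_le K.size, Nat.zero_le (k.distStep W K.size), Nat.zero_le k.chainT.length, Nat.zero_le k.T.length, Nat.zero_le j,
        Nat.zero_le (k.swapBase W K.size)]
    · exact holds_ctxSet fun θ hθ => Or.inr (Or.inr (Or.inr (Or.inl (Or.inr hθ))))
    · exact holds_ctxSet fun θ hθ => Or.inr (Or.inr (Or.inr (Or.inr (Or.inr (Or.inr hθ)))))

/-- **The swap law** `CH(CH(a, r), v) = CH(CH(a, v), r)`: under the hypotheses of `swapAll`, the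
results of `A₂ = CH(res A₁, v)` and `A₄ = CH(res A₃, r)` are provably equal.
[cite: CookReckhow1979, §2] [cite: Krajicek1995, §9.2] -/
theorem swap (hG : CRulesOK G) (hk : k.Rules G) (sh : k.SwapShape A₁ A₂ A₃ A₄ Hs Ht Hp) (av : k.SwapAvail A₁ A₂ A₃ A₄ Hs Ht Hp K Γ)
    {Qs Rs QQs PPs PRs Qp Rp QQp PPp PRp : ℕ → ℕ → Occ}
    (shS : ∀ j < W, k.DistShape (k.So A₁ j) (Hs (j + 1)) (Hs j) (Hs j) (Qs j) (Rs j) (QQs j) (PPs j) (PRs j))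
    (avS : ∀ j < W, k.DistAvail (k.So A₁ j) (Hs (j + 1)) (Hs j) (Hs j) (Qs j) (Rs j) (QQs j) (PPs j) (PRs j) K Γ)
    (shP : ∀ j < W, k.DistShape (k.Po A₁ j) (Hp j) (Ht j) (Hs j) (Qp j) (Rp j) (QQp j) (PPp j) (PRp j))
    (avP : ∀ j < W, k.DistAvail (k.Po A₁ j) (Hp j) (Ht j) (Hs j) (Qp j) (Rp j) (QQp j) (PPp j) (PRp j) K Γ)
    (domHs : ∀ j ≤ W, ∀ j' ≤ W, LtN W K Γ (k.s (Hs j) j') (on W A₁) ∧ LtN W K Γ (k.t (Hs j) j') (on W A₁))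
    (domHt : ∀ j ≤ W, ∀ j' ≤ W, LtN W K Γ (k.s (Ht j) j') (on W A₁) ∧ LtN W K Γ (k.t (Ht j) j') (on W A₁))
    (ht1 : ∀ j ≤ W, LtN W K Γ (k.t A₁ j) (on W A₁)) {Dt0 : ℕ → Sub.View} (cvT0 : k.ChainViews (Ht 0) K Γ)
    (dsT0 : k.DomSupport (Ht 0) Dt0 K Γ) (usT0 : k.UnitSupport (Ht 0) K Γ) (hg : GlobW W k.m K Γ (on W A₁)) :
    G.Yields Γ (ctxSet K (eqW (k.t A₂ W) (k.t A₄ W) W))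
      (k.swapBase W K.size + W * k.swapStep W K.size + (k.chainT.length + 5 * W) * (K.size + 10)) := by
  obtain ⟨Δ, hY, -, hJt⟩ := swapAll hG hk sh av shS avS shP avP domHs domHt ht1 cvT0 dsT0 usT0 hg W le_rfl
  have hΓ : Γ ⊆ Γ ∪ Δ := Set.subset_union_left
  -- `A₂ = CH(res A₁, v)` and `Ht_W = CH(t¹_W, v)` are congruent
  have f1 := (Yields.eqW_refl hG.adder K (k.t A₁ W) W (Γ := Γ ∪ Δ)).union (Yields.eqW_refl hG.adder K (fun i => A₃.inp (W + i)) W)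
  set F1 := ctxSet K (eqW (k.t A₁ W) (k.t A₁ W) W) ∪ ctxSet K (eqW (fun i => A₃.inp (W + i)) (fun i => A₃.inp (W + i)) W) with hF1
  have f2 := chainLeib hG (K := K) (Γ := Γ ∪ Δ ∪ F1) ((av.hA2.mono hΓ).mono Set.subset_union_left) (((av.hHt W le_rfl).mono hΓ).mono Set.subset_union_left)
    (x := k.t A₁ W) (y := fun i => A₃.inp (W + i)) (nw := on W A₁) (x' := k.t A₁ W) (y' := fun i => A₃.inp (W + i)) sh.hA2x sh.hA2y sh.hA2n
    (fun i hi => sh.hHtx W le_rfl i hi) (fun i hi => sh.hHty W le_rfl i hi) (fun i hi => sh.hHtn W le_rfl i hi)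
    (holds_ctxSet fun θ hθ => Or.inr (Or.inl hθ)) (holds_ctxSet fun θ hθ => Or.inr (Or.inr hθ))
  set F2 := F1 ∪ ctxSet K (eqW (k.t A₂ W) (k.t (Ht W) W) W) with hF2
  have f3 := Yields.eqW_trans hG.logic (K := K) (Γ := Γ ∪ Δ ∪ F2) (a := k.t A₂ W) (b := k.t (Ht W) W) (d := k.t A₄ W) (W := W)
    (holds_ctxSet fun θ hθ => Or.inr (Or.inr hθ)) (hJt.mono Set.subset_union_left)
  have h := hY.trans ((f1.trans f2).trans f3)
  exact (h.mono_right fun θ hθ => Or.inr (Or.inr hθ)).mono_size (by nlinarith [Nat.zero_le W, Nat.zero_le K.size, Nat.zero_le k.chainT.length])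

end OpKit

end ModAdd

end Literature.Computability.MetaComplexity
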